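/-
Copyright (c) 2026. All rights reserved.
Released under Apache 2.0 license as described in the file LICENSE.
-/
import Literature.AlgebraicGeometry.Pohlmann1968.MultiquadraticCMFieldWeilSubfieldsProducts
import Literature.NumberTheory.ComplexMultiplication.DegenerateCMTypesElementaryAbelianOrderThirtyTwoWeilFlat
import HarnessLib

/-!
# Twenty-four exceptional Hodge classes in CODIMENSION `2` on every simple degenerate abelian `16`-fold with complex
# multiplication by a multiquadratic CM field of degree `32` — the Weil classes of its three Weil CM subfields of degree `8`

SETTING (tree `MultiquadraticCMFieldWeilSubfields{,ExceptionalClasses,Products}` = g46-#2/#3/#4,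
`DegenerateCMTypesElementaryAbelianOrderThirtyTwoWeilFlat` = g46-#5).  `K` a multiquadratic CM field
(`Gal(K/ℚ)` of exponent `2`), `Φ` a CM type, `A` an abelian variety of type `(K; Φ)` (`IsCMTypeRealisation`,
`dim A = [K:ℚ]/2`), `Bᵖ(A) ⊗ ℂ ⊇ Dᵖ(A) ⊗ ℂ` the Hodge classes and the classes of intersections of divisors in
`H^{2p}(A, ℂ)` with Pohlmann's bases `pohlmannSets Φ p ⊇ pohlmannDivisorSets Φ p` ([Pohlmann1968] Thm. 1; tree
`finrank_hodgeClassSpan_sub_finrank_divisorClassesSpan`: `dim Bᵖ − dim Dᵖ = #(P_p ∖ PD_p)`).  For a subfield `L ⊆ K`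
the type is BALANCED over `L` when every embedding `σ : L → ℂ` has as many extensions inside `Φ` as outside; by
B. Moonen and Yu. Zarhin [MoonenZarhin1998WeilClasses] (Criterion (Q1): «`W_F` consists of Hodge classes iff …
`n_σ = n_σ̄` for all `σ`»; Criterion (Q2) and its proof: for `A` simple of CM type and `F` a CM field the Weil classes
are exceptional; Remark (1)) the space of WEIL CLASSES `W_L ⊂ H^{2[K:L]/2}(A)` — of dimension `[L:ℚ]`, spanned by the
fibre monomials — then consists of Hodge classes, exceptional when `L` is a CM field and `Φ` is primitive (tree
`fibre_mem_pohlmannSets_diff`).  The tree (g46-#2…#4) counted the Weil subfields of degrees `2` and `4`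
(`[K:ℚ]/2 + 1 − Rank` and `C(·, 2)` of them) and their classes in codimension `g/2`, `g/4`; g46-#5 proved at group
level that a rank-`11` type on `(ℤ/2)⁵` has EXACTLY THREE balanced subgroups of index `8` avoiding `ρ`.  THIS FILE is
the Hodge-theoretic reading in degree `32` — where the simple degenerate CM `16`-folds are exactly those of primitive
type of rank `11` (tree `Multiquadratic.cmTypeRank_eq_eleven_of_isSimple_of_not_isNondegenerate`):

> **Theorem** (`ncard_weilOctic_eq_three`, `ncard_weilOctic_eq_three_of_isSimple`).  A primitive CM type of rank `11`
> of a multiquadratic CM field of degree `32` — in particular the type of every simple degenerate CM `16`-fold — is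
> balanced over EXACTLY THREE subfields of degree `8` that are not totally real (its Weil CM subfields of degree `8`).
> **Theorem** (`twentyfour_le_finrank_sub_of_finrank_eq_thirtytwo`, `exists_exceptional_two_of_finrank_eq_thirtytwo`).
> **`dim B²(A) − dim D²(A) ≥ 24` FOR EVERY SIMPLE DEGENERATE ABELIAN `16`-FOLD `A` WITH COMPLEX MULTIPLICATION BY A
> MULTIQUADRATIC CM FIELD OF DEGREE `32`**: twenty-four independent exceptional Hodge classes in `H^{2,2}(A)` — the
> `3 · 8` Weil lines of the three Weil CM subfields of degree `8` — in particular a rational `(2,2)`-class outside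
> `D²(A) ⊗ ℂ` (gen 45: codimension `8`; g46-#3: codimension `4`; now CODIMENSION `2`).
> **Theorem** (`twentyfour_mul_choose_le_finrank_sub_of_finrank_eq_thirtytwo`, `middle_le_…`, `table_le_…`).  With
> products by divisor monomials on the `12` conjugate pairs free of a Weil line:
> **`dim B^{2+j}(A) − dim D^{2+j}(A) ≥ 24·C(12, j)`** — `288, 1584, 5280, 11880, 19008` in codimensions `3…7` and
> **`22176` in the middle dimension** (g46-#4: `4200`).
> **Theorem** (`exists_isSimple_sixteenfold_twentyfour_of_finrank_eq_thirtytwo`).  Such `16`-folds exist over every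
> multiquadratic CM field of degree `32`.
> **Theorem** (§3, append: `pohlmannSets_two_diff_eq_image`, `finrank_sub_two_eq_twentyfour_of_finrank_eq_thirtytwo`).
> **THE COUNT IS EXACT: `dim B²(A) − dim D²(A) = 24`** on every simple degenerate CM `16`-fold with multiquadratic
> complex multiplication of degree `32` — the exceptional Pohlmann sets of degree `2` are EXACTLY the `24` coset-fibres
> (g46-#7 at group level: the conjugation-free balanced `4`-sets are the `24` cosets; here: Pohlmann's `Aut(ℂ)`-condition
> on `σ(D)` is group-level balancedness of `D`, and for a primitive type `P₂ ∖ PD₂` consists of the conjugation-free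
> balanced `4`-sets), so modulo intersections of divisors the Hodge classes of codimension `2` are precisely the Weil
> classes of the three Weil CM subfields of degree `8`, and the Hodge conjecture for `A` in codimension `2` is
> equivalent to their algebraicity.
> **Theorem** (§4, append: `exists_eq_union_pair_of_mem_pohlmannSets_three_diff`, `finrank_sub_three_eq_of_finrank_eq_thirtytwo`).
> **IN CODIMENSION `3` THE COUNT IS EXACT TOO: `dim B³(A) − dim D³(A) = 288 = 24 · 12`** — every exceptional
> Pohlmann set of degree `3` is a Weil `4`-set plus a free conjugate pair (a conjugation-free balanced `6`-set would
> contradict g46-#9's `4 ∣ |D|`), so modulo intersections of divisors the Hodge classes of codimension `3` are the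
> products (Weil class of an octic Weil subfield) × (divisor class).
> **Theorem** (§5, append: `exists_decomposition_of_isGaloisBalanced`, `exists_decomposition_of_mem_pohlmannSets`,
> `exists_decomposition_of_isSimple`).  **EVERY `Φ`-BALANCED SET — every member of Pohlmann's basis of every
> `Bᵖ(A) ⊗ ℂ` — IS A DISJOINT UNION OF EXCEPTIONAL WEIL `4`-SETS AND CONJUGATE PAIRS** (g46-#11 at group level:
> the conjugation-free balanced sets are disjoint unions of the `24` cosets): on the index sets, Pohlmann's basis of
> the whole Hodge ring `B^•(A) ⊗ ℂ` of a simple degenerate CM `16`-fold with multiquadratic complex multiplication of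
> degree `32` is made of products of divisor monomials and the `24` Weil monomials of codimension `2`.
> **Theorem** (§7, append: `finrank_le_eight_of_weil`, `ncard_weilSubfields_eq_twentyfour`).  **EXACTLY `24` WEIL
> CM SUBFIELDS** for a rank-`11` type of a multiquadratic CM field of degree `32`: a Weil CM subfield has degree
> `2`, `4` or `8` (no Weil subgroups of index `16`, `32`, g46-#15) and there are `6 + 15 + 3` of them.
> **Theorem** (§8, append: `isGaloisBalanced_univ_sdiff`, `pohlmannSets_fifteen_subset`, `finrank_sub_pos_iff`).
> **WHERE THE EXCEPTIONAL CLASSES ARE: `Bᵖ(A) ≠ Dᵖ(A)` exactly for `2 ≤ p ≤ 14`** on these `16`-folds (the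
> complement of a balanced set is balanced; `P₁₅ = PD₁₅`).
> **Theorem** (§9, append: `ncard_diff_eq_ncard_diff_sub`, `finrank_sub_eq_finrank_sub`,
> `finrank_sub_fourteen_thirteen_eq_of_isSimple`).  **THE SYMMETRY `p ↔ 16 − p`**: complementation is a bijection
> `P_p ∖ PD_p ≃ P_{16−p} ∖ PD_{16−p}`, so `dim Bᵖ − dim Dᵖ = dim B¹⁶⁻ᵖ − dim D¹⁶⁻ᵖ`; in particular
> `dim B¹⁴ − dim D¹⁴ = 24` and `dim B¹³ − dim D¹³ = 288` exactly.

* §0 (group level, exponent `2`) `ncard_cosets_eq_index_mul` (the cosets of a family of index-`i` subgroups number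
  `i·#family`; g46-#3 had `i = 4`).
* §1 `ncard_indexEight_balanced_gal_eq_three` (g46-#5 read on `Gal(K/ℚ)`), `card_image_coset_of_index_eight`,
  **`image_coset_mem_pohlmannSets_diff_of_index_eight`** (coset-fibres of a balanced index-`8` subgroup `H ∌ ρ` are
  exceptional Pohlmann sets of degree `[K:ℚ]/16`), `image_fixingSubgroup_weilOctic_eq`, **`ncard_weilOctic_eq_three`**,
  `ncard_weilOctic_eq_three_of_isSimple`.
* §2 **`twentyfour_mul_choose_le_finrank_sub`** (`[K:ℚ] = 32`, `Φ` primitive of rank `11`, every realisation, every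
  `j`), `twentyfour_le_finrank_sub_two`, **`twentyfour_le_finrank_sub_of_finrank_eq_thirtytwo`**,
  `twentyfour_mul_choose_le_finrank_sub_of_finrank_eq_thirtytwo`, `middle_le_finrank_sub_of_finrank_eq_thirtytwo`,
  `table_le_finrank_sub_of_finrank_eq_thirtytwo`, `exists_exceptional_two_of_finrank_eq_thirtytwo`,
  `exists_isSimple_sixteenfold_twentyfour_of_finrank_eq_thirtytwo`.
* §3 (append, g46-#8) **`isGaloisBalanced_image_embOf_iff`** (Pohlmann's condition on `σ(D)` ⟺ group-level
  balancedness of `D`), **`mem_pohlmannSets_two_diff_iff`** (primitive type: `P₂ ∖ PD₂` = conjugation-free balanced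
  `4`-sets), **`pohlmannSets_two_diff_eq_image`**, **`finrank_sub_two_eq_twentyfour`**,
  **`finrank_sub_two_eq_twentyfour_of_finrank_eq_thirtytwo`**, `exists_isSimple_sixteenfold_eq_twentyfour_of_finrank_eq_thirtytwo`.
* §4 (append, g46-#10) `ncard_pohlmannSets_two_diff_eq` (`#(P₂ ∖ PD₂) = 24`), **`exists_pair_of_mem_pohlmannSets_three_diff`**,
  **`exists_eq_union_pair_of_mem_pohlmannSets_three_diff`** (decomposition `Δ = Δ' ⊔ {φ, φ̄}`),
  `ncard_pohlmannSets_three_diff_le` (`≤ 288`), **`finrank_sub_three_eq`**, **`finrank_sub_three_eq_of_finrank_eq_thirtytwo`**.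
* §5 (append, g46-#12) **`exists_decomposition_of_isGaloisBalanced`**, `exists_decomposition_of_mem_pohlmannSets`,
  `exists_decomposition_of_isSimple` (every balanced set = Weil `4`-sets ⊔ conjugate pairs).
* §6 (append, g46-#13) `exists_pair_of_mem_pohlmannSets_odd`, `exists_pair_of_mem_pohlmannSets_odd_of_isSimple` (odd
  codimension: every Pohlmann basis set contains a conjugate pair).
* §7 (append, g46-#16) `finrank_le_eight_of_weil`, `finrank_eq_or_of_weil`, **`ncard_weilSubfields_eq_twentyfour`**,
  `ncard_weilSubfields_eq_twentyfour_of_isSimple` (exactly `24` Weil CM subfields, degrees `2/4/8` = `6/15/3`).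
* §8 (append, g46-#16) `isGaloisBalanced_univ_sdiff` (complements), `pohlmannSets_fifteen_subset` (`P₁₅ = PD₁₅`),
  **`finrank_sub_pos_iff`**, `finrank_sub_pos_iff_of_isSimple` (`Bᵖ ≠ Dᵖ ⟺ 2 ≤ p ≤ 14`).
* §9 (append, g46-#17) `univ_sdiff_mem_diff`, **`ncard_diff_eq_ncard_diff_sub`**, `finrank_sub_eq_finrank_sub`,
  `finrank_sub_fourteen_thirteen_eq_of_isSimple` (the symmetry `p ↔ 16 − p`; exact `24`, `288` at `p = 14, 13`).

HONEST SCOPE.  Exact in codimensions `2, 3` (§3–§4) and `13, 14` (§9), and a complete description of Pohlmann's index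
sets in all codimensions (§5) — but the COUNTS in codimensions `4, …, 12` are lower bounds: a direct enumeration (seat
computation, not used in the proofs) gives `dim Bᵖ − dim Dᵖ = 24, 288, 1740, 6528, 16392, 28320, 33996` for
`p = 2, …, 8` on these `16`-folds, so the bounds of §2 are sharp in codimensions `2` and `3` only (where §3–§4 prove
equality).  Degree `32` only (the group-level structure theorem of g46-#5 is special to order `32`); §0–§1 are
general.  The sources print the Weil-class criteria (Moonen–Zarhin), Pohlmann's bases, the rank machinery (Kubota,
Dodson) and the Galois correspondence; the counts `3`, `24`, `288`, `24·C(12, j)` are DERIVED here (with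
g46-#5/#7/#9), not printed.  On the Hodge conjecture itself nothing is claimed: E. Markman [Markman2025SecantWeil]
§1.1 (abstract) proves the algebraicity of the Hodge–Weil classes on polarized abelian SIXFOLDS of Weil type of
discriminant `−1` (whence the Hodge conjecture for abelian fourfolds), which does not cover these CM `16`-folds and
their Weil subfields of degree `8`; the classes here are exceptional (not in the span of intersections of divisors)
and their algebraicity is OPEN.  THEOREMS ONLY: no definition,
no named fact, no instance, no `sorry`.

## References

* [MoonenZarhin1998WeilClasses] B. J. J. Moonen, Yu. G. Zarhin, *Weil classes on abelian varieties*, J. reine angew.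
  Math. 496 (1998) (arXiv:alg-geom/9612017), Criterion (Q1), Criterion (Q2) with proof, Remark (1).
* [Pohlmann1968] H. Pohlmann, *Algebraic cycles on abelian varieties of complex multiplication type*, Ann. of Math. 88
  (1968), Thm. 1.
* [Gordon1999HodgeAVSurvey] B. B. Gordon, *A survey of the Hodge conjecture for abelian varieties*, 9.2.2, 5.13 (ii),
  9.4.1, 9.4.3.
* [vanGeemen1994HodgeAV] B. van Geemen, *An introduction to the Hodge conjecture for abelian varieties*, Thm. 4.5, 4.7.
* [Kubota1965] T. Kubota, Trans. AMS 118 (1965), §4 Lemma 2.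
* [Dodson1984] B. Dodson, Trans. AMS 283 (1984), §3.1.1 Theorem, §3.2.1.
* [Shimura1998] G. Shimura, *Abelian Varieties with Complex Multiplication and Modular Functions*, §6.2 Thm. 3, §8.1,
  §18.2 Lemma (i).
* [MilneFT2022] J. S. Milne, *Fields and Galois Theory*, Thm. 3.16.
* [Markman2025SecantWeil] E. Markman, arXiv:2502.03415, §1.1 (honest scope).

## Provenance

Lane `lit-hodgefound` (Track 2, Layer A4/A5), seat `lit-hodgefound-p10` generation 46, rows g46-#6 (§0–§2), g46-#8
(§3), g46-#10 (§4), g46-#12 (§5), g46-#13 (§6), g46-#16 (§7–§8), g46-#17 (§9); neighbours cited by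
name, nothing restated: `BalancedCosetsThirtyTwo` (g46-#5/#7/#9: `ncard_indexEight_balanced_eq_three`,
`setOf_balanced_four_eq`, `card_ne_six_of_balanced_free`, `exists_cosets_of_balanced_free`, `index_le_eight_of_balanced`,
USED),
`CMTypeRankCharactersNumberField` (`smul_embOf_of_comp`,
`exists_algEquiv_comp_eq_smul`, `exists_ringEquiv_comp_eq_algEquiv`), `NondegenerateCMTypeDivisorClasses`
(`isGaloisBalanced_iff_two_mul`, `mem_pohlmannSets_one_iff_of_isPrimitive`, `conj_smul_eq_conjugate`),
`MultiquadraticWeilSubfields` (g46-#2: `forall_fibre_iff_forall_coset`, `filter_comp_eq_eq_image`,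
`conjugate_comp_ne_of_not_isTotallyReal`, `card_filter_mul_mem_fixingSubgroup_eq_ncard`, `ncard_weilBiquadratic_eq_fifteen`),
`MultiquadraticWeilSubfieldsProducts` (g46-#4: `union_mem_pohlmannSets`, `union_not_mem_pohlmannDivisorSets`,
`pairUnion_mem_pohlmannDivisorSets`, `card_freeComplement`, `conjugate_not_mem_image_coset`), `WeilTypeCMSubfield…`
(`fibre_mem_pohlmannSets_diff`), `DivisorClassesCMType` (`finrank_hodgeClassSpan_sub_finrank_divisorClassesSpan`,
`exists_exceptional_iff`, `pohlmannDivisorSets_subset_pohlmannSets`), `Multiquadratic` (degree-`32` facts),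
`CyclicTwoOddPrimes` (`isCMTypeWith_galType`, `cmTypeRank_eq_typeRank_galType`), `CMNumbers`/`AbelianKernels`
(Galois correspondence with `ρ`).
-/

open scoped BigOperators NumberField IsMulCommutative Classical
open NumberField Module CategoryTheory CategoryTheory.Limits IntermediateField

namespace Literature.AlgebraicGeometry.Pohlmann1968

namespace MultiquadraticWeilSubfieldsDegreeEight

open scoped Literature.NumberTheory.ComplexMultiplication
open Literature.NumberTheory.ComplexMultiplication (twistStabilizer IsCMTypeWith conjGal IsPrimitive typeRank
  pattern_primitive_iff_twistStabilizer_eq_bot)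
open Literature.NumberTheory.ComplexMultiplication.BalancedCosetsThirtyTwo (ncard_indexEight_balanced_eq_three
  setOf_balanced_four_eq card_ne_six_of_balanced_free exists_cosets_of_balanced_free index_le_eight_of_balanced)
open Literature.AlgebraicGeometry.Pohlmann1968.MultiquadraticWeilSubfields (filter_comp_eq_eq_image
  forall_fibre_iff_forall_coset conjugate_comp_ne_of_not_isTotallyReal card_filter_mul_mem_fixingSubgroup_eq_ncard
  ncard_weilBiquadratic_eq_fifteen)
open Literature.AlgebraicGeometry.Pohlmann1968.MultiquadraticWeilSubfieldsProducts (union_mem_pohlmannSets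
  union_not_mem_pohlmannDivisorSets pairUnion_mem_pohlmannDivisorSets card_freeComplement
  conjugate_not_mem_image_coset fortyTwoHundred_le_finrank_sub_of_finrank_eq_thirtytwo)
open Literature.AlgebraicGeometry.Pohlmann1968.MultiquadraticWeilSubfieldsClasses
  (sixty_le_finrank_sub_of_finrank_eq_thirtytwo)
open Literature.NumberTheory.ComplexMultiplication.CMNumbers (index_fixingSubgroup_eq_finrank
  conjGal_not_mem_fixingSubgroup_iff)
open Literature.AlgebraicGeometry.Pohlmann1968.AbelianKernels (index_eq_finrank_fixedField
  conjGal_not_mem_iff_not_isTotallyReal_fixedField)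
open Literature.AlgebraicGeometry.Pohlmann1968.CyclicTwoOddPrimes (isCMTypeWith_galType cmTypeRank_eq_typeRank_galType)
open Literature.AlgebraicGeometry.Pohlmann1968.Multiquadratic
  (cmTypeRank_eq_eleven_of_isSimple_of_not_isNondegenerate isSimple_iff_cmTypeRank_eq_eleven_or_seventeen
  exists_isPrimitive_cmTypeRank_eq_eleven cmTypeRank_add_ncard_weilQuadratic_eq)
open Literature.AlgebraicGeometry.Motives (CMType AbelianVariety)
open Literature.AlgebraicGeometry.HodgeTheory
open Literature.AlgebraicGeometry.VanGeemen1994 (hodgeClassSpan)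
open Literature.Barriers.HodgeConjecture (divisorClassesSpan)
open Literature.AlgebraicGeometry.ComplexMultiplication (IsCMTypeRealisation exists_isCMTypeRealisation
  isPrimitive_ringEquiv_complex_iff isSimple_iff_isPrimitive)

/-! ## §0 Group level: the cosets of a family of index-`i` subgroups number `i·#family` -/

section Cosets

variable {G : Type*} [CommGroup G] [Fintype G] [DecidableEq G]

omit [DecidableEq G] in
/-- The translate `{u : x·u ∈ H}` has `|H|` elements. [folklore] -/
private theorem card_filter_univ_mul_mem_de (H : Subgroup G) (x : G) :
    (Finset.univ.filter fun u : G => x * u ∈ H).card = Nat.card H := by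
  have e : Nat.card H = (Finset.univ.filter fun g : G => g ∈ H).card := by
    rw [Nat.card_eq_fintype_card, ← Fintype.card_subtype]
  rw [e]
  refine Finset.card_bij (fun u _ => x * u) (fun u hu => ?_) (fun a _ b _ hab => mul_left_cancel hab)
    (fun k hk => ⟨x⁻¹ * k, ?_, by rw [mul_inv_cancel_left]⟩)
  · simpa using hu
  · simpa using hk

omit [Fintype G] [DecidableEq G] in
/-- `g·g = 1` in exponent `2`. [folklore] -/
private theorem mul_self_de (hexp : ∀ g : G, g ^ 2 = 1) (g : G) : g * g = 1 := by
  rw [← pow_two]; exact hexp g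

omit [DecidableEq G] in
/-- Two cosets `{t : x·t ∈ H}`, `{t : y·t ∈ H}` (exponent `2`) coincide iff `x·y ∈ H`. [folklore] -/
private theorem filter_eq_filter_iff_de (hexp : ∀ g : G, g ^ 2 = 1) (H : Subgroup G) (x y : G) :
    (Finset.univ.filter fun t : G => x * t ∈ H) = (Finset.univ.filter fun t : G => y * t ∈ H) ↔ x * y ∈ H := by
  constructor
  · intro h
    have hy : y ∈ Finset.univ.filter fun t : G => y * t ∈ H := by
      simp only [Finset.mem_filter, Finset.mem_univ, true_and, mul_self_de hexp]; exact H.one_mem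
    rw [← h] at hy
    simpa using hy
  · intro hxy
    ext t
    simp only [Finset.mem_filter, Finset.mem_univ, true_and]
    have e : y * t = (x * y) * (x * t) := by
      rw [mul_mul_mul_comm, mul_self_de hexp, one_mul]
    constructor
    · intro hxt; rw [e]; exact H.mul_mem hxy hxt
    · intro hyt
      have := H.mul_mem hxy hyt
      rwa [e, ← mul_assoc, mul_self_de hexp, one_mul] at this

omit [DecidableEq G] in
/-- A coset determines its subgroup. [folklore] -/
private theorem eq_of_filter_eq_filter_de (hexp : ∀ g : G, g ^ 2 = 1) {H H' : Subgroup G} {x y : G}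
    (h : (Finset.univ.filter fun t : G => x * t ∈ H) = (Finset.univ.filter fun t : G => y * t ∈ H')) : H = H' := by
  have key : ∀ t : G, x * t ∈ H ↔ y * t ∈ H' := fun t => by
    have := Finset.ext_iff.1 h t
    simpa using this
  have hyx : y * x ∈ H' := (key x).1 (by rw [mul_self_de hexp]; exact H.one_mem)
  have hxy : x * y ∈ H := (key y).2 (by rw [mul_self_de hexp]; exact H'.one_mem)
  ext k
  constructor
  · intro hk
    have h1 : y * (x * k) ∈ H' := (key (x * k)).1 (by rw [← mul_assoc, mul_self_de hexp, one_mul]; exact hk)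
    have := H'.mul_mem h1 (H'.inv_mem hyx)
    rwa [← mul_assoc, mul_inv_cancel_comm] at this
  · intro hk
    have h1 : x * (y * k) ∈ H := (key (y * k)).2 (by rw [← mul_assoc, mul_self_de hexp, one_mul]; exact hk)
    have := H.mul_mem h1 (H.inv_mem hxy)
    rwa [← mul_assoc, mul_inv_cancel_comm] at this

/-- A subgroup has `[G:H]` cosets, counted as subsets `{t : x·t ∈ H}`. [folklore] -/
private theorem card_image_filter_eq_index_de (hexp : ∀ g : G, g ^ 2 = 1) (H : Subgroup G) :
    (Finset.univ.image fun x : G => Finset.univ.filter fun t : G => x * t ∈ H).card = H.index := by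
  have hfib : ∀ C ∈ Finset.univ.image (fun x : G => Finset.univ.filter fun t : G => x * t ∈ H),
      (Finset.univ.filter fun y : G => (Finset.univ.filter fun t : G => y * t ∈ H) = C).card = Nat.card H := by
    intro C hC
    obtain ⟨x, -, rfl⟩ := Finset.mem_image.1 hC
    rw [← card_filter_univ_mul_mem_de H x]
    congr 1
    ext y
    simp only [Finset.mem_filter, Finset.mem_univ, true_and]
    rw [filter_eq_filter_iff_de hexp, mul_comm]
  have hsum := Finset.card_eq_sum_card_image (fun x : G => Finset.univ.filter fun t : G => x * t ∈ H) Finset.univ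
  rw [Finset.sum_congr rfl hfib, Finset.sum_const, smul_eq_mul, Finset.card_univ] at hsum
  have hci := H.card_mul_index
  rw [Nat.card_eq_fintype_card (α := G), hsum] at hci
  have hpos : 0 < Nat.card H := Nat.card_pos
  rw [mul_comm] at hci
  exact (Nat.eq_of_mul_eq_mul_right hpos hci).symm

/-- **THE COSETS OF A FAMILY OF INDEX-`i` SUBGROUPS NUMBER `i · #family`** (cosets of distinct subgroups are distinct
subsets; tree g46-#3 for `i = 4`).  Field side: the fibres over the embeddings of the Weil subfields of degree `i` are
`i` per subfield and pairwise distinct. [cite: Dodson1984, §3.1.1] -/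
theorem ncard_cosets_eq_index_mul (hexp : ∀ g : G, g ^ 2 = 1) (i : ℕ) (P : Subgroup G → Prop) :
    {C : Finset G | ∃ H : Subgroup G, H.index = i ∧ P H ∧ ∃ x : G, C = Finset.univ.filter fun t : G => x * t ∈ H}.ncard =
      i * {H : Subgroup G | H.index = i ∧ P H}.ncard := by
  set S : Finset (Subgroup G) := Finset.univ.filter fun H : Subgroup G => H.index = i ∧ P H with hS
  have hSncard : {H : Subgroup G | H.index = i ∧ P H}.ncard = S.card := by
    rw [← Set.ncard_coe_finset]; congr 1; ext H; simp [hS]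
  set f : Subgroup G → Finset (Finset G) := fun H =>
    Finset.univ.image fun x : G => Finset.univ.filter fun t : G => x * t ∈ H with hf
  have hset : {C : Finset G | ∃ H : Subgroup G, H.index = i ∧ P H ∧
      ∃ x : G, C = Finset.univ.filter fun t : G => x * t ∈ H} = ↑(S.biUnion f) := by
    ext C
    simp only [Set.mem_setOf_eq, Finset.coe_biUnion, Finset.mem_coe, Set.mem_iUnion, hS, hf, Finset.mem_filter,
      Finset.mem_univ, true_and, Finset.mem_image, exists_prop]
    constructor
    · rintro ⟨H, hH, hP, x, rfl⟩
      exact ⟨H, ⟨hH, hP⟩, x, rfl⟩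
    · rintro ⟨H, ⟨hH, hP⟩, x, rfl⟩
      exact ⟨H, hH, hP, x, rfl⟩
  have hdisj : (S : Set (Subgroup G)).PairwiseDisjoint f := by
    intro H _ H' _ hne
    rw [Function.onFun, Finset.disjoint_left]
    intro C hC hC'
    simp only [hf, Finset.mem_image, Finset.mem_univ, true_and] at hC hC'
    obtain ⟨x, rfl⟩ := hC
    obtain ⟨y, hy⟩ := hC'
    exact hne (eq_of_filter_eq_filter_de hexp hy.symm)
  rw [hset, Set.ncard_coe_finset, Finset.card_biUnion hdisj, hSncard]
  have hSi : ∀ H ∈ S, (f H).card = i := by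
    intro H hH
    rw [hf, card_image_filter_eq_index_de hexp H]
    exact (Finset.mem_filter.1 hH).2.1
  rw [Finset.sum_congr rfl hSi, Finset.sum_const, smul_eq_mul, mul_comm]

end Cosets

/-! ## §1 The Galois group of a multiquadratic CM field of degree `32`: three balanced subgroups of index `8` -/

section Gal

variable {K : Type} [Field K] [NumberField K] [IsCMField K] [IsGalois ℚ K]

omit [IsGalois ℚ K] in
/-- `φ₀ ∘ ρ = conj ∘ φ₀`. [cite: Shimura1998, §18.2 Lemma (i)] -/
private theorem apply_conjGal_eq_de (φ₀ : K →+* ℂ) (x : K) :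
    φ₀ ((conjGal : K ≃ₐ[ℚ] K) x) = starRingEnd ℂ (φ₀ x) :=
  AbelianCMFieldExistence.apply_conjGal_eq φ₀ x

/-- The group-level type `T_Φ = {s : σ_s ∈ Φ}` is a CM type of `Gal(K/ℚ)` w.r.t. `ρ`. [cite: Shimura1998, §8.1] -/
private theorem isCMTypeWith_T_de (hexp : ∀ g : K ≃ₐ[ℚ] K, g ^ 2 = 1) (φ₀ : K →+* ℂ) (Φ : CMType K) :
    IsCMTypeWith (conjGal : K ≃ₐ[ℚ] K)
      (↑(Finset.univ.filter fun s : K ≃ₐ[ℚ] K => embOf φ₀ s ∈ Φ.1) : Set (K ≃ₐ[ℚ] K)) := by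
  haveI := Multiquadratic.isAbelianGalois_of_forall_sq_eq_one hexp
  exact isCMTypeWith_galType (apply_conjGal_eq_de φ₀) Φ

/-- **`[K:ℚ] = 32`, `Rank(Φ) = 11`: EXACTLY THREE subgroups `H ∌ ρ` of `Gal(K/ℚ)` of index `8` have all cosets
`T_Φ`-balanced** — the group-level structure theorem of the tree (`ncard_indexEight_balanced_eq_three`) read on the
Galois group; field side: `Φ` is of Weil type over exactly three CM subfields of degree `8`.
[cite: MoonenZarhin1998WeilClasses, Criterion (Q1)] [cite: Kubota1965, §4 Lemma 2] [cite: Dodson1984, §3.1.1 Theorem] -/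
theorem ncard_indexEight_balanced_gal_eq_three (hexp : ∀ g : K ≃ₐ[ℚ] K, g ^ 2 = 1) (h32 : finrank ℚ K = 32)
    (φ₀ : K →+* ℂ) (Φ : CMType K) (hr : cmTypeRank Φ = 11) :
    {H : Subgroup (K ≃ₐ[ℚ] K) | H.index = 8 ∧ (conjGal : K ≃ₐ[ℚ] K) ∉ H ∧
      ∀ x : K ≃ₐ[ℚ] K, 2 * ((Finset.univ.filter fun s : K ≃ₐ[ℚ] K => embOf φ₀ s ∈ Φ.1).filter
        fun t => x * t ∈ H).card = Nat.card H}.ncard = 3 := by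
  haveI := Multiquadratic.isAbelianGalois_of_forall_sq_eq_one hexp
  have hcard : Fintype.card (K ≃ₐ[ℚ] K) = 32 := by rw [card_gal_eq_finrank φ₀, h32]
  have hrank : typeRank (K ≃ₐ[ℚ] K)
      (↑(Finset.univ.filter fun s : K ≃ₐ[ℚ] K => embOf φ₀ s ∈ Φ.1) : Set (K ≃ₐ[ℚ] K)) = 11 := by
    rw [← cmTypeRank_eq_typeRank_galType Φ φ₀]; exact hr
  exact ncard_indexEight_balanced_eq_three hexp (isCMTypeWith_T_de hexp φ₀ Φ) hcard hrank

omit [IsCMField K] in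
/-- `|σ(xH)| = |H| = [K:ℚ]/8` for `H` of index `8`. [cite: Shimura1998, §8.1] -/
theorem card_image_coset_of_index_eight (hexp : ∀ g : K ≃ₐ[ℚ] K, g ^ 2 = 1) (φ₀ : K →+* ℂ)
    {H : Subgroup (K ≃ₐ[ℚ] K)} (hH : H.index = 8) (x : K ≃ₐ[ℚ] K) :
    ((Finset.univ.filter fun t : K ≃ₐ[ℚ] K => x * t ∈ H).image (embOf φ₀)).card = finrank ℚ K / 8 := by
  haveI := Multiquadratic.isAbelianGalois_of_forall_sq_eq_one hexp
  rw [Finset.card_image_of_injective _ (embOf_bijective φ₀).1, card_filter_univ_mul_mem_de H x]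
  have h := H.card_mul_index
  rw [hH, Nat.card_eq_fintype_card (α := K ≃ₐ[ℚ] K), card_gal_eq_finrank φ₀] at h
  omega

/-- **THE COSET-FIBRES OF AN INDEX-`8` SUBGROUP `H ∌ ρ` WITH BALANCED COSETS ARE EXCEPTIONAL POHLMANN SETS OF DEGREE
`[K:ℚ]/16`** (`Φ` primitive): the image `{σ_t : x·t ∈ H}` is the fibre of `Hom(K, ℂ) → Hom(L, ℂ)` over a non-real
embedding of the CM subfield `L = K^H` of degree `8` over which `Φ` is balanced — a Weil line of `(A, L)` outside
`D^{[K:ℚ]/16}(A) ⊗ ℂ` (tree g46-#3 for index `4`). [cite: MoonenZarhin1998WeilClasses, Criterion (Q1) and Criterion (Q2)]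
[cite: Gordon1999HodgeAVSurvey, 9.2.2 and 5.13 (ii)] [cite: Pohlmann1968, Thm. 1] -/
theorem image_coset_mem_pohlmannSets_diff_of_index_eight (hexp : ∀ g : K ≃ₐ[ℚ] K, g ^ 2 = 1) (φ₀ : K →+* ℂ)
    (Φ : CMType K) (hprim : IsPrimitive (ℂ ≃+* ℂ) Φ.1 φ₀) {H : Subgroup (K ≃ₐ[ℚ] K)} (hH : H.index = 8)
    (hρ : (conjGal : K ≃ₐ[ℚ] K) ∉ H)
    (hbal : ∀ x : K ≃ₐ[ℚ] K, 2 * ((Finset.univ.filter fun s : K ≃ₐ[ℚ] K => embOf φ₀ s ∈ Φ.1).filter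
      fun t => x * t ∈ H).card = Nat.card H)
    (x : K ≃ₐ[ℚ] K) :
    (Finset.univ.filter fun t : K ≃ₐ[ℚ] K => x * t ∈ H).image (embOf φ₀) ∈
      pohlmannSets Φ (finrank ℚ K / 16) \ pohlmannDivisorSets Φ (finrank ℚ K / 16) := by
  haveI := Multiquadratic.isAbelianGalois_of_forall_sq_eq_one hexp
  set L : IntermediateField ℚ K := fixedField H with hLdef
  have hLH : L.fixingSubgroup = H := fixingSubgroup_fixedField H
  have hLr : ¬ IsTotallyReal L := (conjGal_not_mem_iff_not_isTotallyReal_fixedField H).1 hρ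
  have hW : ∀ σ : L →+* ℂ, {φ : K →+* ℂ | φ.comp (algebraMap L K) = σ ∧ φ ∈ Φ.1}.ncard =
      {φ : K →+* ℂ | φ.comp (algebraMap L K) = σ ∧ φ ∉ Φ.1}.ncard := by
    rw [forall_fibre_iff_forall_coset hexp φ₀ Φ L, hLH]; exact hbal
  have hne := conjugate_comp_ne_of_not_isTotallyReal hexp hLr ((embOf φ₀ x).comp (algebraMap L K))
  have hmem := fibre_mem_pohlmannSets_diff (algebraMap L K) φ₀ hprim hW hne
  have hdeg : {φ : K →+* ℂ | φ.comp (algebraMap L K) = (embOf φ₀ x).comp (algebraMap L K) ∧ φ ∈ Φ.1}.ncard =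
      finrank ℚ K / 16 := by
    rw [← card_filter_mul_mem_fixingSubgroup_eq_ncard hexp φ₀ Φ L x, hLH]
    have h1 := hbal x
    have h2 := H.card_mul_index
    rw [hH, Nat.card_eq_fintype_card (α := K ≃ₐ[ℚ] K), card_gal_eq_finrank φ₀] at h2
    omega
  rw [hdeg, filter_comp_eq_eq_image hexp φ₀ L x, hLH] at hmem
  exact hmem

omit [IsCMField K] in
/-- `L ↦ Gal(K/L)` is injective (Galois correspondence). [cite: MilneFT2022, Thm. 3.16] -/
private theorem fixingSubgroup_injective_de :
    Function.Injective fun F : IntermediateField ℚ K => F.fixingSubgroup := by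
  intro F F' h
  have h' : F.fixingSubgroup = F'.fixingSubgroup := h
  rw [← IsGalois.fixedField_fixingSubgroup F, h', IsGalois.fixedField_fixingSubgroup]

/-- **Galois correspondence for the Weil subfields of degree `8`**: `L ↦ Gal(K/L)` maps the subfields `L` of degree `8`,
not totally real, over which `Φ` is balanced onto the index-`8` subgroups `H ∌ ρ` all of whose cosets are balanced.
[cite: MoonenZarhin1998WeilClasses, Criterion (Q1)] [cite: MilneFT2022, Thm. 3.16] -/
theorem image_fixingSubgroup_weilOctic_eq (hexp : ∀ g : K ≃ₐ[ℚ] K, g ^ 2 = 1) (φ₀ : K →+* ℂ) (Φ : CMType K) :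
    (fun L : IntermediateField ℚ K => L.fixingSubgroup) ''
      {L : IntermediateField ℚ K | finrank ℚ L = 8 ∧ ¬ IsTotallyReal L ∧
        ∀ σ : L →+* ℂ, {φ : K →+* ℂ | φ.comp (algebraMap L K) = σ ∧ φ ∈ Φ.1}.ncard =
          {φ : K →+* ℂ | φ.comp (algebraMap L K) = σ ∧ φ ∉ Φ.1}.ncard} =
      {H : Subgroup (K ≃ₐ[ℚ] K) | H.index = 8 ∧ (conjGal : K ≃ₐ[ℚ] K) ∉ H ∧
        ∀ x : K ≃ₐ[ℚ] K, 2 * ((Finset.univ.filter fun s : K ≃ₐ[ℚ] K => embOf φ₀ s ∈ Φ.1).filter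
          fun t => x * t ∈ H).card = Nat.card H} := by
  haveI := Multiquadratic.isAbelianGalois_of_forall_sq_eq_one hexp
  ext H
  simp only [Set.mem_image, Set.mem_setOf_eq]
  constructor
  · rintro ⟨L, ⟨hL, hLr, hbal⟩, rfl⟩
    exact ⟨by rw [index_fixingSubgroup_eq_finrank L, hL], (conjGal_not_mem_fixingSubgroup_iff L).2 hLr,
      (forall_fibre_iff_forall_coset hexp φ₀ Φ L).1 hbal⟩
  · rintro ⟨hH, hρ, hbal⟩
    refine ⟨fixedField H, ⟨by rw [← index_eq_finrank_fixedField H, hH],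
      (conjGal_not_mem_iff_not_isTotallyReal_fixedField H).1 hρ, ?_⟩, fixingSubgroup_fixedField H⟩
    rw [forall_fibre_iff_forall_coset hexp φ₀ Φ (fixedField H), fixingSubgroup_fixedField]
    exact hbal

/-- **★★ EXACTLY THREE WEIL CM SUBFIELDS OF DEGREE `8`**: a primitive CM type of rank `11` of a multiquadratic CM field
`K` of degree `32` is balanced (of WEIL TYPE, Moonen–Zarhin (Q1)) over exactly three subfields `L ⊆ K` of degree `8`
that are not totally real — together with the tree's `6` imaginary quadratic and `15` biquadratic ones, these are the
CM subfields over which the abelian `16`-folds of the type carry Weil–Hodge classes.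
[cite: MoonenZarhin1998WeilClasses, Criterion (Q1)] [cite: Kubota1965, §4 Lemma 2] [cite: Dodson1984, §3.1.1 Theorem]
[cite: MilneFT2022, Thm. 3.16] -/
theorem ncard_weilOctic_eq_three (hexp : ∀ g : K ≃ₐ[ℚ] K, g ^ 2 = 1) (h32 : finrank ℚ K = 32) (Φ : CMType K)
    (hr : cmTypeRank Φ = 11) :
    {L : IntermediateField ℚ K | finrank ℚ L = 8 ∧ ¬ IsTotallyReal L ∧
      ∀ σ : L →+* ℂ, {φ : K →+* ℂ | φ.comp (algebraMap L K) = σ ∧ φ ∈ Φ.1}.ncard =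
        {φ : K →+* ℂ | φ.comp (algebraMap L K) = σ ∧ φ ∉ Φ.1}.ncard}.ncard = 3 := by
  obtain ⟨φ₀⟩ := (inferInstance : Nonempty (K →+* ℂ))
  rw [← Set.ncard_image_of_injective _ fixingSubgroup_injective_de, image_fixingSubgroup_weilOctic_eq hexp φ₀ Φ]
  exact ncard_indexEight_balanced_gal_eq_three hexp h32 φ₀ Φ hr

/-- **… for the type of a SIMPLE DEGENERATE abelian `16`-fold** with complex multiplication by `K`, `[K:ℚ] = 32`:
exactly three Weil CM subfields of degree `8`. [cite: MoonenZarhin1998WeilClasses, Criterion (Q1)]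
[cite: Dodson1984, §3.1.1 Theorem and §3.2.1] -/
theorem ncard_weilOctic_eq_three_of_isSimple {A : AbelianVariety ℂ} {ι : 𝓞 K →+* End A}
    {θ : K →+* Module.End ℂ (complexBetti A.X 1)} (hexp : ∀ g : K ≃ₐ[ℚ] K, g ^ 2 = 1) (h32 : finrank ℚ K = 32)
    (Φ : CMType K) (hA : IsCMTypeRealisation Φ A ι θ) (hs : A.IsSimple) (hnd : ¬ IsNondegenerate Φ) :
    {L : IntermediateField ℚ K | finrank ℚ L = 8 ∧ ¬ IsTotallyReal L ∧
      ∀ σ : L →+* ℂ, {φ : K →+* ℂ | φ.comp (algebraMap L K) = σ ∧ φ ∈ Φ.1}.ncard =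
        {φ : K →+* ℂ | φ.comp (algebraMap L K) = σ ∧ φ ∉ Φ.1}.ncard}.ncard = 3 :=
  ncard_weilOctic_eq_three hexp h32 Φ (cmTypeRank_eq_eleven_of_isSimple_of_not_isNondegenerate hexp h32 Φ hA hs hnd)

end Gal

/-! ## §2 ★★ Degree `32`: twenty-four exceptional Weil classes in CODIMENSION `2`, and their products with divisors -/

section ThirtyTwo

variable {K : Type} [Field K] [NumberField K] [IsCMField K] [IsGalois ℚ K]
  {A : AbelianVariety ℂ} {ι : 𝓞 K →+* End A} {θ : K →+* Module.End ℂ (complexBetti A.X 1)}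

omit [NumberField K] [IsCMField K] [IsGalois ℚ K] in
/-- `conj (conj φ) = φ`. [folklore] -/
private theorem conjugate_conjugate_de (φ : K →+* ℂ) :
    ComplexEmbedding.conjugate (ComplexEmbedding.conjugate φ) = φ := star_star φ

omit [NumberField K] [IsCMField K] [IsGalois ℚ K] in
/-- Recovery of a conjugation-free `Δ` from `Δ ∪ E`, `E` conjugation-closed and disjoint. [folklore] -/
private theorem filter_union_eq_of_free_de {Δ E : Finset (K →+* ℂ)}
    (hfree : ∀ φ ∈ Δ, ComplexEmbedding.conjugate φ ∉ Δ) (hE : ∀ φ ∈ E, ComplexEmbedding.conjugate φ ∈ E)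
    (hdisj : Disjoint Δ E) :
    (Δ ∪ E).filter (fun φ => ComplexEmbedding.conjugate φ ∉ Δ ∪ E) = Δ := by
  ext φ
  simp only [Finset.mem_filter, Finset.mem_union, not_or]
  constructor
  · rintro ⟨hφ | hφ, h1, h2⟩
    · exact hφ
    · exact absurd (hE φ hφ) h2
  · intro hφ
    refine ⟨Or.inl hφ, hfree φ hφ, fun h => ?_⟩
    have h2 := hE _ h
    rw [conjugate_conjugate_de] at h2
    exact Finset.disjoint_left.1 hdisj hφ h2

omit [NumberField K] [IsCMField K] [IsGalois ℚ K] in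
/-- … and of `E`. [folklore] -/
private theorem sdiff_union_eq_of_disjoint_de {Δ E : Finset (K →+* ℂ)} (hdisj : Disjoint Δ E) :
    (Δ ∪ E) \ Δ = E := by
  rw [Finset.union_sdiff_left, Finset.sdiff_eq_self_iff_disjoint]
  exact hdisj.symm

omit [NumberField K] [IsCMField K] [IsGalois ℚ K] in
/-- `Q ⊔ Q̄` is conjugation-closed. [folklore] -/
private theorem conjugate_mem_pairUnion_de {Q : Finset (K →+* ℂ)} {φ : K →+* ℂ}
    (hφ : φ ∈ Q ∪ Q.image ComplexEmbedding.conjugate) :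
    ComplexEmbedding.conjugate φ ∈ Q ∪ Q.image ComplexEmbedding.conjugate := by
  rcases Finset.mem_union.1 hφ with h | h
  · exact Finset.mem_union_right _ (Finset.mem_image_of_mem _ h)
  · obtain ⟨ψ, hψ, rfl⟩ := Finset.mem_image.1 h
    rw [conjugate_conjugate_de]
    exact Finset.mem_union_left _ hψ

omit [NumberField K] [IsCMField K] [IsGalois ℚ K] in
/-- `Q` is recovered from `Q ⊔ Q̄` as its members in `Φ`. [folklore] -/
private theorem filter_pairUnion_eq_de {Φ : CMType K} {Q : Finset (K →+* ℂ)} (hQ : ∀ φ ∈ Q, φ ∈ Φ.1) :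
    (Q ∪ Q.image ComplexEmbedding.conjugate).filter (fun φ => φ ∈ Φ.1) = Q := by
  ext φ
  simp only [Finset.mem_filter, Finset.mem_union, Finset.mem_image]
  constructor
  · rintro ⟨h | ⟨ψ, hψ, rfl⟩, hΦ⟩
    · exact h
    · exact absurd hΦ ((Φ.2 ψ).1 (hQ ψ hψ))
  · exact fun h => ⟨Or.inl h, hQ φ h⟩

/-- **★★ `[K:ℚ] = 32`, `Φ` PRIMITIVE OF RANK `11`: `dim B^{2+j}(A) − dim D^{2+j}(A) ≥ 24·C(12, j)` FOR EVERY ABELIAN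
`16`-FOLD OF TYPE `(K; Φ)` AND EVERY `j`** — the `3 · 8 = 24` exceptional Weil lines `Δ` of CODIMENSION `2` (the
coset-fibres of the three Weil CM subfields of degree `8`: conjugation-free balanced `4`-sets of embeddings), each
multiplied by the divisor monomials on `j` of the `12` conjugate pairs free of `Δ`, are pairwise distinct exceptional
classes in `H^{2(2+j)}(A)`. [cite: MoonenZarhin1998WeilClasses, Criterion (Q1), Criterion (Q2) (proof) and Remark (1)]
[cite: Gordon1999HodgeAVSurvey, 9.2.2 and 5.13 (ii)] [cite: Pohlmann1968, Thm. 1] [cite: Kubota1965, §4 Lemma 2]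
[cite: Dodson1984, §3.1.1 Theorem] -/
theorem twentyfour_mul_choose_le_finrank_sub (hexp : ∀ g : K ≃ₐ[ℚ] K, g ^ 2 = 1) (h32 : finrank ℚ K = 32)
    (φ₀ : K →+* ℂ) (Φ : CMType K) (hprim : IsPrimitive (ℂ ≃+* ℂ) Φ.1 φ₀) (hr : cmTypeRank Φ = 11)
    (hA : IsCMTypeRealisation Φ A ι θ) (j : ℕ) :
    24 * Nat.choose 12 j ≤
      Module.finrank ℂ ↥(hodgeClassSpan (finrank ℚ K / 2) A.X (2 + j)) -
        Module.finrank ℂ ↥(divisorClassesSpan A.X (finrank ℚ K / 2) (2 + j)) := by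
  haveI := Multiquadratic.isAbelianGalois_of_forall_sq_eq_one hexp
  rw [finrank_hodgeClassSpan_sub_finrank_divisorClassesSpan hA (2 + j)]
  have h24 : {C : Finset (K ≃ₐ[ℚ] K) | ∃ H : Subgroup (K ≃ₐ[ℚ] K), H.index = 8 ∧
      ((conjGal : K ≃ₐ[ℚ] K) ∉ H ∧ ∀ x : K ≃ₐ[ℚ] K, 2 * ((Finset.univ.filter fun s : K ≃ₐ[ℚ] K =>
        embOf φ₀ s ∈ Φ.1).filter fun t => x * t ∈ H).card = Nat.card H) ∧
      ∃ x : K ≃ₐ[ℚ] K, C = Finset.univ.filter fun t : K ≃ₐ[ℚ] K => x * t ∈ H}.ncard = 24 := by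
    rw [ncard_cosets_eq_index_mul hexp 8, ncard_indexEight_balanced_gal_eq_three hexp h32 φ₀ Φ hr]
  rw [← h24]
  have h16 : finrank ℚ K / 16 = 2 := by rw [h32]
  have h8 : finrank ℚ K / 8 = 4 := by rw [h32]
  have h2 : finrank ℚ K / 2 = 16 := by rw [h32]
  -- the coset family
  set 𝒞 : Set (Finset (K ≃ₐ[ℚ] K)) := {C | ∃ H : Subgroup (K ≃ₐ[ℚ] K), H.index = 8 ∧
      ((conjGal : K ≃ₐ[ℚ] K) ∉ H ∧ ∀ x : K ≃ₐ[ℚ] K, 2 * ((Finset.univ.filter fun s : K ≃ₐ[ℚ] K =>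
        embOf φ₀ s ∈ Φ.1).filter fun t => x * t ∈ H).card = Nat.card H) ∧
      ∃ x : K ≃ₐ[ℚ] K, C = Finset.univ.filter fun t : K ≃ₐ[ℚ] K => x * t ∈ H} with h𝒞
  set Δ : Finset (K ≃ₐ[ℚ] K) → Finset (K →+* ℂ) := fun C => C.image (embOf φ₀) with hΔ
  set S : Finset (K ≃ₐ[ℚ] K) → Finset (K →+* ℂ) := fun C =>
    Finset.univ.filter fun φ : K →+* ℂ => φ ∈ Φ.1 ∧ φ ∉ Δ C ∧ ComplexEmbedding.conjugate φ ∉ Δ C with hS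
  set U : Finset (K ≃ₐ[ℚ] K) → Finset (K →+* ℂ) → Finset (K →+* ℂ) := fun C Q =>
    Δ C ∪ (Q ∪ Q.image ComplexEmbedding.conjugate) with hU
  have hfacts : ∀ C ∈ 𝒞, Δ C ∈ pohlmannSets Φ 2 \ pohlmannDivisorSets Φ 2 ∧
      (∀ φ ∈ Δ C, ComplexEmbedding.conjugate φ ∉ Δ C) ∧ (S C).card = 12 := by
    rintro C ⟨H, hH, ⟨hρ, hbal⟩, x, rfl⟩
    have h1 : Δ _ ∈ _ := h16 ▸ image_coset_mem_pohlmannSets_diff_of_index_eight hexp φ₀ Φ hprim hH hρ hbal x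
    have hfree := conjugate_not_mem_image_coset hexp φ₀ hρ x
    refine ⟨h1, hfree, ?_⟩
    show (Finset.univ.filter fun φ : K →+* ℂ => φ ∈ Φ.1 ∧ φ ∉ Δ _ ∧ ComplexEmbedding.conjugate φ ∉ Δ _).card = 12
    rw [card_freeComplement hfree]
    show finrank ℚ K / 2 - ((Finset.univ.filter fun t : K ≃ₐ[ℚ] K => x * t ∈ H).image (embOf φ₀)).card = 12
    rw [card_image_coset_of_index_eight hexp φ₀ hH x, h2, h8]
  have hUmem : ∀ C ∈ 𝒞, ∀ Q ∈ (S C).powersetCard j, U C Q ∈ pohlmannSets Φ (2 + j) \ pohlmannDivisorSets Φ (2 + j) := by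
    intro C hC Q hQ
    obtain ⟨hΔC, hfree, -⟩ := hfacts C hC
    rw [Finset.mem_powersetCard] at hQ
    have hQS : ∀ φ ∈ Q, φ ∈ Φ.1 ∧ φ ∉ Δ C ∧ ComplexEmbedding.conjugate φ ∉ Δ C := fun φ hφ => by
      have := hQ.1 hφ; simpa [hS] using this
    have hQΦ : ∀ φ ∈ Q, φ ∈ Φ.1 := fun φ hφ => (hQS φ hφ).1
    have hdisj : Disjoint (Δ C) (Q ∪ Q.image ComplexEmbedding.conjugate) := by
      rw [Finset.disjoint_right]
      intro φ hφ
      rcases Finset.mem_union.1 hφ with h | h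
      · exact (hQS φ h).2.1
      · obtain ⟨ψ, hψ, rfl⟩ := Finset.mem_image.1 h
        exact (hQS ψ hψ).2.2
    have hE : Q ∪ Q.image ComplexEmbedding.conjugate ∈ pohlmannSets Φ j := by
      have := pohlmannDivisorSets_subset_pohlmannSets Φ Q.card (pairUnion_mem_pohlmannDivisorSets φ₀ hprim Q hQΦ)
      rwa [hQ.2] at this
    exact ⟨union_mem_pohlmannSets hΔC.1 hE hdisj,
      union_not_mem_pohlmannDivisorSets φ₀ hprim hΔC (fun φ hφ => conjugate_mem_pairUnion_de hφ) hdisj _⟩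
  have hrecΔ : ∀ C ∈ 𝒞, ∀ Q ∈ (S C).powersetCard j,
      (U C Q).filter (fun φ => ComplexEmbedding.conjugate φ ∉ U C Q) = Δ C := by
    intro C hC Q hQ
    obtain ⟨-, hfree, -⟩ := hfacts C hC
    rw [Finset.mem_powersetCard] at hQ
    have hQS : ∀ φ ∈ Q, φ ∈ Φ.1 ∧ φ ∉ Δ C ∧ ComplexEmbedding.conjugate φ ∉ Δ C := fun φ hφ => by
      have := hQ.1 hφ; simpa [hS] using this
    have hdisj : Disjoint (Δ C) (Q ∪ Q.image ComplexEmbedding.conjugate) := by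
      rw [Finset.disjoint_right]
      intro φ hφ
      rcases Finset.mem_union.1 hφ with h | h
      · exact (hQS φ h).2.1
      · obtain ⟨ψ, hψ, rfl⟩ := Finset.mem_image.1 h
        exact (hQS ψ hψ).2.2
    exact filter_union_eq_of_free_de hfree (fun φ hφ => conjugate_mem_pairUnion_de hφ) hdisj
  have hrecQ : ∀ C ∈ 𝒞, ∀ Q ∈ (S C).powersetCard j,
      ((U C Q) \ Δ C).filter (fun φ => φ ∈ Φ.1) = Q := by
    intro C hC Q hQ
    rw [Finset.mem_powersetCard] at hQ
    have hQS : ∀ φ ∈ Q, φ ∈ Φ.1 ∧ φ ∉ Δ C ∧ ComplexEmbedding.conjugate φ ∉ Δ C := fun φ hφ => by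
      have := hQ.1 hφ; simpa [hS] using this
    have hdisj : Disjoint (Δ C) (Q ∪ Q.image ComplexEmbedding.conjugate) := by
      rw [Finset.disjoint_right]
      intro φ hφ
      rcases Finset.mem_union.1 hφ with h | h
      · exact (hQS φ h).2.1
      · obtain ⟨ψ, hψ, rfl⟩ := Finset.mem_image.1 h
        exact (hQS ψ hψ).2.2
    show ((Δ C ∪ (Q ∪ Q.image ComplexEmbedding.conjugate)) \ Δ C).filter (fun φ => φ ∈ Φ.1) = Q
    rw [sdiff_union_eq_of_disjoint_de hdisj]
    exact filter_pairUnion_eq_de fun φ hφ => (hQS φ hφ).1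
  have h𝒞fin : 𝒞.Finite := Set.toFinite _
  set 𝒞f : Finset (Finset (K ≃ₐ[ℚ] K)) := h𝒞fin.toFinset with h𝒞f
  have hmem𝒞f : ∀ {C}, C ∈ 𝒞f ↔ C ∈ 𝒞 := by intro C; exact Set.Finite.mem_toFinset h𝒞fin
  set F : Finset (K ≃ₐ[ℚ] K) → Finset (Finset (K →+* ℂ)) := fun C => ((S C).powersetCard j).image (U C) with hF
  have hdisjF : (↑𝒞f : Set (Finset (K ≃ₐ[ℚ] K))).PairwiseDisjoint F := by
    intro C hC C' hC' hne
    rw [Function.onFun, Finset.disjoint_left]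
    intro V hV hV'
    simp only [hF, Finset.mem_image] at hV hV'
    obtain ⟨Q, hQ, rfl⟩ := hV
    obtain ⟨Q', hQ', hUU⟩ := hV'
    have hC𝒞 : C ∈ 𝒞 := hmem𝒞f.1 hC
    have hC'𝒞 : C' ∈ 𝒞 := hmem𝒞f.1 hC'
    have hΔeq : Δ C' = Δ C := by
      rw [← hrecΔ C hC𝒞 Q hQ, ← hrecΔ C' hC'𝒞 Q' hQ', hUU]
    have hinj : Function.Injective fun C : Finset (K ≃ₐ[ℚ] K) => C.image (embOf φ₀) := by
      intro C₁ C₂ h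
      have h' : (embOf φ₀) '' (↑C₁ : Set (K ≃ₐ[ℚ] K)) = (embOf φ₀) '' ↑C₂ := by
        rw [← Finset.coe_image, ← Finset.coe_image]; exact congrArg _ h
      exact Finset.coe_inj.1 ((embOf_bijective φ₀).1.image_injective h')
    exact hne (hinj hΔeq).symm
  have hcardF : ∀ C ∈ 𝒞f, (F C).card = Nat.choose 12 j := by
    intro C hC
    have hC𝒞 : C ∈ 𝒞 := hmem𝒞f.1 hC
    obtain ⟨-, -, hScard⟩ := hfacts C hC𝒞
    rw [hF, Finset.card_image_of_injOn, Finset.card_powersetCard, hScard]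
    intro Q hQ Q' hQ' hQQ'
    have h1 := hrecQ C hC𝒞 Q hQ
    have h2' := hrecQ C hC𝒞 Q' hQ'
    rw [← h1, ← h2']
    exact congrArg (fun V => (V \ Δ C).filter fun φ => φ ∈ Φ.1) hQQ'
  have hsub : (↑(𝒞f.biUnion F) : Set (Finset (K →+* ℂ))) ⊆ pohlmannSets Φ (2 + j) \ pohlmannDivisorSets Φ (2 + j) := by
    intro V hV
    rw [Finset.mem_coe, Finset.mem_biUnion] at hV
    obtain ⟨C, hC, hV⟩ := hV
    simp only [hF, Finset.mem_image] at hV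
    obtain ⟨Q, hQ, rfl⟩ := hV
    exact hUmem C (hmem𝒞f.1 hC) Q hQ
  have hcount : (𝒞f.biUnion F).card = 𝒞.ncard * Nat.choose 12 j := by
    rw [Finset.card_biUnion hdisjF, Finset.sum_congr rfl hcardF, Finset.sum_const, smul_eq_mul,
      Set.ncard_eq_toFinset_card 𝒞 h𝒞fin]
  calc 𝒞.ncard * Nat.choose 12 j = (↑(𝒞f.biUnion F) : Set (Finset (K →+* ℂ))).ncard := by
        rw [Set.ncard_coe_finset, hcount]
    _ ≤ (pohlmannSets Φ (2 + j) \ pohlmannDivisorSets Φ (2 + j)).ncard := Set.ncard_le_ncard hsub (Set.toFinite _)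

/-- **★★ CODIMENSION `2`: `dim B²(A) − dim D²(A) ≥ 24`** for every abelian `16`-fold of type `(K; Φ)`, `[K:ℚ] = 32`,
`Φ` primitive of rank `11` — twenty-four independent exceptional Hodge classes in `H⁴(A) = H^{2,2}`, the Weil classes
of the three Weil CM subfields of degree `8`. [cite: MoonenZarhin1998WeilClasses, Criterion (Q1) and Criterion (Q2)]
[cite: Gordon1999HodgeAVSurvey, 9.2.2 and 5.13 (ii)] [cite: Pohlmann1968, Thm. 1] -/
theorem twentyfour_le_finrank_sub_two (hexp : ∀ g : K ≃ₐ[ℚ] K, g ^ 2 = 1) (h32 : finrank ℚ K = 32)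
    (φ₀ : K →+* ℂ) (Φ : CMType K) (hprim : IsPrimitive (ℂ ≃+* ℂ) Φ.1 φ₀) (hr : cmTypeRank Φ = 11)
    (hA : IsCMTypeRealisation Φ A ι θ) :
    24 ≤ Module.finrank ℂ ↥(hodgeClassSpan (finrank ℚ K / 2) A.X 2) -
        Module.finrank ℂ ↥(divisorClassesSpan A.X (finrank ℚ K / 2) 2) := by
  have h := twentyfour_mul_choose_le_finrank_sub hexp h32 φ₀ Φ hprim hr hA 0
  simpa using h

/-- **★★ EVERY SIMPLE DEGENERATE ABELIAN `16`-FOLD WITH COMPLEX MULTIPLICATION BY A MULTIQUADRATIC CM FIELD OF DEGREE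
`32` HAS `dim B²(A) − dim D²(A) ≥ 24`**: exceptional Hodge classes already in CODIMENSION `2` (its type is primitive
of rank `11`; gen 45: codimension `8`, g46-#3: codimension `4`). [cite: MoonenZarhin1998WeilClasses, Criterion (Q1) and Criterion (Q2)]
[cite: Gordon1999HodgeAVSurvey, 9.2.2] [cite: Dodson1984, §3.1.1 Theorem and §3.2.1] [cite: Pohlmann1968, Thm. 1] -/
theorem twentyfour_le_finrank_sub_of_finrank_eq_thirtytwo (hexp : ∀ g : K ≃ₐ[ℚ] K, g ^ 2 = 1)
    (h32 : finrank ℚ K = 32) (Φ : CMType K) (hA : IsCMTypeRealisation Φ A ι θ) (hs : A.IsSimple)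
    (hnd : ¬ IsNondegenerate Φ) :
    24 ≤ Module.finrank ℂ ↥(hodgeClassSpan (finrank ℚ K / 2) A.X 2) -
        Module.finrank ℂ ↥(divisorClassesSpan A.X (finrank ℚ K / 2) 2) := by
  obtain ⟨φ₀⟩ := (inferInstance : Nonempty (K →+* ℂ))
  exact twentyfour_le_finrank_sub_two hexp h32 φ₀ Φ ((isSimple_iff_isPrimitive hA φ₀).1 hs)
    (cmTypeRank_eq_eleven_of_isSimple_of_not_isNondegenerate hexp h32 Φ hA hs hnd) hA

/-- **… with products: `dim B^{2+j}(A) − dim D^{2+j}(A) ≥ 24·C(12, j)`** on every simple degenerate CM `16`-fold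
(`[K:ℚ] = 32`). [cite: MoonenZarhin1998WeilClasses, Criterion (Q2) (proof) and Remark (1)] [cite: Gordon1999HodgeAVSurvey, 9.2.2] -/
theorem twentyfour_mul_choose_le_finrank_sub_of_finrank_eq_thirtytwo (hexp : ∀ g : K ≃ₐ[ℚ] K, g ^ 2 = 1)
    (h32 : finrank ℚ K = 32) (Φ : CMType K) (hA : IsCMTypeRealisation Φ A ι θ) (hs : A.IsSimple)
    (hnd : ¬ IsNondegenerate Φ) (j : ℕ) :
    24 * Nat.choose 12 j ≤ Module.finrank ℂ ↥(hodgeClassSpan (finrank ℚ K / 2) A.X (2 + j)) -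
        Module.finrank ℂ ↥(divisorClassesSpan A.X (finrank ℚ K / 2) (2 + j)) := by
  obtain ⟨φ₀⟩ := (inferInstance : Nonempty (K →+* ℂ))
  exact twentyfour_mul_choose_le_finrank_sub hexp h32 φ₀ Φ ((isSimple_iff_isPrimitive hA φ₀).1 hs)
    (cmTypeRank_eq_eleven_of_isSimple_of_not_isNondegenerate hexp h32 Φ hA hs hnd) hA j

/-- **THE MIDDLE DIMENSION: `dim B⁸(A) − dim D⁸(A) ≥ 22176 = 24·C(12, 6)`** on every simple degenerate CM `16`-fold
(`[K:ℚ] = 32`; g46-#4 gave `4200`). [cite: MoonenZarhin1998WeilClasses, Criterion (Q2) (proof) and Remark (1)]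
[cite: Gordon1999HodgeAVSurvey, 9.2.2] -/
theorem middle_le_finrank_sub_of_finrank_eq_thirtytwo (hexp : ∀ g : K ≃ₐ[ℚ] K, g ^ 2 = 1)
    (h32 : finrank ℚ K = 32) (Φ : CMType K) (hA : IsCMTypeRealisation Φ A ι θ) (hs : A.IsSimple)
    (hnd : ¬ IsNondegenerate Φ) :
    22176 ≤ Module.finrank ℂ ↥(hodgeClassSpan (finrank ℚ K / 2) A.X 8) -
        Module.finrank ℂ ↥(divisorClassesSpan A.X (finrank ℚ K / 2) 8) := by
  have h := twentyfour_mul_choose_le_finrank_sub_of_finrank_eq_thirtytwo hexp h32 Φ hA hs hnd 6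
  have e : 24 * Nat.choose 12 6 = 22176 := by decide
  rw [e] at h
  exact h

/-- **THE TABLE OF LOWER BOUNDS `24·C(12, j)`, codimensions `3, …, 7`: `288, 1584, 5280, 11880, 19008`** on every simple
degenerate CM `16`-fold (`[K:ℚ] = 32`). [cite: MoonenZarhin1998WeilClasses, Criterion (Q2) (proof) and Remark (1)]
[cite: Gordon1999HodgeAVSurvey, 9.2.2] -/
theorem table_le_finrank_sub_of_finrank_eq_thirtytwo (hexp : ∀ g : K ≃ₐ[ℚ] K, g ^ 2 = 1)
    (h32 : finrank ℚ K = 32) (Φ : CMType K) (hA : IsCMTypeRealisation Φ A ι θ) (hs : A.IsSimple)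
    (hnd : ¬ IsNondegenerate Φ) :
    288 ≤ Module.finrank ℂ ↥(hodgeClassSpan (finrank ℚ K / 2) A.X 3) -
        Module.finrank ℂ ↥(divisorClassesSpan A.X (finrank ℚ K / 2) 3) ∧
    1584 ≤ Module.finrank ℂ ↥(hodgeClassSpan (finrank ℚ K / 2) A.X 4) -
        Module.finrank ℂ ↥(divisorClassesSpan A.X (finrank ℚ K / 2) 4) ∧
    5280 ≤ Module.finrank ℂ ↥(hodgeClassSpan (finrank ℚ K / 2) A.X 5) -
        Module.finrank ℂ ↥(divisorClassesSpan A.X (finrank ℚ K / 2) 5) ∧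
    11880 ≤ Module.finrank ℂ ↥(hodgeClassSpan (finrank ℚ K / 2) A.X 6) -
        Module.finrank ℂ ↥(divisorClassesSpan A.X (finrank ℚ K / 2) 6) ∧
    19008 ≤ Module.finrank ℂ ↥(hodgeClassSpan (finrank ℚ K / 2) A.X 7) -
        Module.finrank ℂ ↥(divisorClassesSpan A.X (finrank ℚ K / 2) 7) := by
  have h := twentyfour_mul_choose_le_finrank_sub_of_finrank_eq_thirtytwo hexp h32 Φ hA hs hnd
  refine ⟨?_, ?_, ?_, ?_, ?_⟩
  · have h1 := h 1; have e : 24 * Nat.choose 12 1 = 288 := by decide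
    rw [e] at h1; exact h1
  · have h1 := h 2; have e : 24 * Nat.choose 12 2 = 1584 := by decide
    rw [e] at h1; exact h1
  · have h1 := h 3; have e : 24 * Nat.choose 12 3 = 5280 := by decide
    rw [e] at h1; exact h1
  · have h1 := h 4; have e : 24 * Nat.choose 12 4 = 11880 := by decide
    rw [e] at h1; exact h1
  · have h1 := h 5; have e : 24 * Nat.choose 12 5 = 19008 := by decide
    rw [e] at h1; exact h1

/-- **A RATIONAL `(2,2)`-CLASS OUTSIDE `D²(A) ⊗ ℂ`** on every simple degenerate abelian `16`-fold with complex
multiplication by `K`, `[K:ℚ] = 32` — an exceptional Hodge class in codimension `2`.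
[cite: MoonenZarhin1998WeilClasses, Criterion (Q2)] [cite: vanGeemen1994HodgeAV, Thm. 4.5 and 4.7]
[cite: Gordon1999HodgeAVSurvey, 9.2.2] -/
theorem exists_exceptional_two_of_finrank_eq_thirtytwo (hexp : ∀ g : K ≃ₐ[ℚ] K, g ^ 2 = 1)
    (h32 : finrank ℚ K = 32) (Φ : CMType K) (hA : IsCMTypeRealisation Φ A ι θ) (hs : A.IsSimple)
    (hnd : ¬ IsNondegenerate Φ) :
    ∃ c : complexBetti A.X (2 * 2), IsRationalClass c ∧
      IsOfHodgeType (finrank ℚ K / 2) A.X (2 * 2) 2 2 c ∧ c ∉ divisorClassesSpan A.X (finrank ℚ K / 2) 2 := by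
  rw [exists_exceptional_iff hA 2]
  have h := twentyfour_le_finrank_sub_of_finrank_eq_thirtytwo hexp h32 Φ hA hs hnd
  rw [finrank_hodgeClassSpan_sub_finrank_divisorClassesSpan hA 2] at h
  exact Set.nonempty_of_ncard_ne_zero (by omega)

/-- **EXISTENCE** (`[K:ℚ] = 32`): every multiquadratic CM field of degree `32` carries a CM type (primitive, rank
`11`) all of whose abelian varieties are simple `16`-folds with `dim B² − dim D² ≥ 24` and `dim B⁸ − dim D⁸ ≥ 22176`,
and such an abelian variety exists. [cite: Shimura1998, §6.2 Thm. 3] [cite: MoonenZarhin1998WeilClasses, Criterion (Q2)]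
[cite: Dodson1984, §3.2.1] -/
theorem exists_isSimple_sixteenfold_twentyfour_of_finrank_eq_thirtytwo (hexp : ∀ g : K ≃ₐ[ℚ] K, g ^ 2 = 1)
    (h32 : finrank ℚ K = 32) :
    ∃ (Φ : CMType K) (A : AbelianVariety ℂ) (ι : 𝓞 K →+* End A) (θ : K →+* Module.End ℂ (complexBetti A.X 1)),
      IsCMTypeRealisation Φ A ι θ ∧ cmTypeRank Φ = 11 ∧ A.IsSimple ∧ A.dim = 16 ∧
        24 ≤ Module.finrank ℂ ↥(hodgeClassSpan (finrank ℚ K / 2) A.X 2) -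
          Module.finrank ℂ ↥(divisorClassesSpan A.X (finrank ℚ K / 2) 2) ∧
        22176 ≤ Module.finrank ℂ ↥(hodgeClassSpan (finrank ℚ K / 2) A.X 8) -
          Module.finrank ℂ ↥(divisorClassesSpan A.X (finrank ℚ K / 2) 8) := by
  obtain ⟨Φ, hr, hnd, -⟩ := exists_isPrimitive_cmTypeRank_eq_eleven hexp h32
  obtain ⟨A, ι, θ, hA⟩ := exists_isCMTypeRealisation Φ
  have hs : A.IsSimple := (isSimple_iff_cmTypeRank_eq_eleven_or_seventeen hexp h32 Φ hA).2 (Or.inl hr)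
  have hdim : A.dim = finrank ℚ K / 2 := Literature.AlgebraicGeometry.Motives.schemeDim_eq_holds hA.1
  exact ⟨Φ, A, ι, θ, hA, hr, hs, by rw [hdim, h32],
    twentyfour_le_finrank_sub_of_finrank_eq_thirtytwo hexp h32 Φ hA hs hnd,
    middle_le_finrank_sub_of_finrank_eq_thirtytwo hexp h32 Φ hA hs hnd⟩

end ThirtyTwo

/-! ## §3 ★★ The exact count in codimension `2`: `dim B²(A) − dim D²(A) = 24` (append, g46-#8) -/

section Exact

variable {K : Type} [Field K] [NumberField K] [IsCMField K] [IsGalois ℚ K]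
  {A : AbelianVariety ℂ} {ι : 𝓞 K →+* End A} {θ : K →+* Module.End ℂ (complexBetti A.X 1)}

omit [IsCMField K] in
/-- **Pohlmann's condition for `σ(D) = {σ_t : t ∈ D}` is the group-level balancedness of `D`**: `Aut(ℂ)` acts on
`Hom(K, ℂ)` through `Gal(K/ℚ)` (`τσ_g = σ_{gδ⁻¹}` for `τφ₀ = φ₀δ`; every `δ` arises), so
`|τσ(D) ∩ Φ| = |τσ(D) ∩ Φ̄|` for all `τ` iff `2·#{t ∈ D : xt ∈ T_Φ} = |D|` for all `x ∈ Gal(K/ℚ)`.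
[cite: Pohlmann1968, Thm. 1] [cite: Gordon1999HodgeAVSurvey, §9.2 (9.2.1)] [cite: Shimura1998, §8.1] -/
theorem isGaloisBalanced_image_embOf_iff (hexp : ∀ g : K ≃ₐ[ℚ] K, g ^ 2 = 1) (φ₀ : K →+* ℂ) (Φ : CMType K)
    (D : Finset (K ≃ₐ[ℚ] K)) :
    IsGaloisBalanced Φ (D.image (embOf φ₀)) ↔
      ∀ x : K ≃ₐ[ℚ] K, 2 * (D.filter fun t =>
        x * t ∈ (Finset.univ.filter fun s : K ≃ₐ[ℚ] K => embOf φ₀ s ∈ Φ.1)).card = D.card := by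
  haveI := Multiquadratic.isAbelianGalois_of_forall_sq_eq_one hexp
  have hinj := (embOf_bijective φ₀).1
  rw [isGaloisBalanced_iff_two_mul, Finset.card_image_of_injective _ hinj]
  -- the count for `τ` with `τφ₀ = φ₀δ` is the group-level count at `x = δ⁻¹`
  have key : ∀ (τ : ℂ ≃+* ℂ) (δ : K ≃ₐ[ℚ] K), (∀ y, τ (φ₀ y) = φ₀ (δ y)) →
      {s | s ∈ D.image (embOf φ₀) ∧ (τ : ℂ →+* ℂ).comp s ∈ Φ.1}.ncard =
        (D.filter fun t => δ⁻¹ * t ∈ (Finset.univ.filter fun s : K ≃ₐ[ℚ] K => embOf φ₀ s ∈ Φ.1)).card := by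
    intro τ δ hδ
    have hset : {s | s ∈ D.image (embOf φ₀) ∧ (τ : ℂ →+* ℂ).comp s ∈ Φ.1} =
        (embOf φ₀) '' ↑(D.filter fun t => δ⁻¹ * t ∈
          (Finset.univ.filter fun s : K ≃ₐ[ℚ] K => embOf φ₀ s ∈ Φ.1)) := by
      ext s
      simp only [Set.mem_setOf_eq, Finset.mem_image, Set.mem_image, Finset.coe_filter, Finset.mem_filter,
        Finset.mem_univ, true_and]
      constructor
      · rintro ⟨⟨t, ht, rfl⟩, hs⟩
        refine ⟨t, ⟨ht, ?_⟩, rfl⟩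
        have h1 : τ • embOf φ₀ t = embOf φ₀ (t * δ⁻¹) := smul_embOf_of_comp φ₀ hδ t
        rw [mul_comm] at h1
        rw [← h1]; exact hs
      · rintro ⟨t, ⟨ht, hmem⟩, rfl⟩
        refine ⟨⟨t, ht, rfl⟩, ?_⟩
        have h1 : τ • embOf φ₀ t = embOf φ₀ (t * δ⁻¹) := smul_embOf_of_comp φ₀ hδ t
        rw [mul_comm] at h1
        show τ • embOf φ₀ t ∈ Φ.1
        rw [h1]; exact hmem
    rw [hset, Set.ncard_image_of_injective _ hinj, Set.ncard_coe_finset]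
  constructor
  · intro h x
    obtain ⟨τ, hτ⟩ := exists_ringEquiv_comp_eq_algEquiv φ₀ x⁻¹
    have := h τ
    rw [key τ x⁻¹ hτ, inv_inv] at this
    exact this
  · intro h τ
    obtain ⟨γ, hγ⟩ := exists_algEquiv_comp_eq_smul φ₀ τ
    rw [key τ γ hγ]
    exact h γ⁻¹

/-- `σ̄_t = σ_{ρt}`. [cite: Shimura1998, §18.2 Lemma (i)] -/
private theorem conjugate_embOf_de (hexp : ∀ g : K ≃ₐ[ℚ] K, g ^ 2 = 1) (φ₀ : K →+* ℂ) (t : K ≃ₐ[ℚ] K) :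
    ComplexEmbedding.conjugate (embOf φ₀ t) = embOf φ₀ ((conjGal : K ≃ₐ[ℚ] K) * t) := by
  haveI := Multiquadratic.isAbelianGalois_of_forall_sq_eq_one hexp
  have h := smul_embOf_of_comp φ₀ (τ := starRingAut) (δ := (conjGal : K ≃ₐ[ℚ] K))
    (fun x => (apply_conjGal_eq_de φ₀ x).symm) t
  rw [conj_smul_eq_conjugate] at h
  have hinv : (conjGal : K ≃ₐ[ℚ] K)⁻¹ = conjGal :=
    inv_eq_of_mul_eq_one_right (by rw [← pow_two]; exact hexp _)
  rw [h, hinv, mul_comm]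

omit [NumberField K] in
/-- `φ ≠ φ̄` for every embedding of a CM field (a CM type contains exactly one of them). [cite: Shimura1998, §18.1] -/
private theorem conjugate_ne_de (Φ : CMType K) (φ : K →+* ℂ) : ComplexEmbedding.conjugate φ ≠ φ := by
  intro h
  have := Φ.2 φ
  rw [h] at this
  exact iff_not_self this

omit [IsGalois ℚ K] in
/-- **In degree `2` the exceptional Pohlmann sets of a PRIMITIVE type are exactly the conjugation-free balanced
`4`-sets**: `Δ ∈ P₂ ∖ PD₂ ⟺ |Δ| = 4 ∧ Δ balanced ∧ Δ ∩ Δ̄ = ∅` (for a primitive type the balanced pairs are the conjugate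
pairs, so a balanced `4`-set containing one conjugate pair is the union of two).
[cite: Gordon1999HodgeAVSurvey, 9.2.2] [cite: Pohlmann1968, Thm. 1] [cite: vanGeemen1994HodgeAV, §2.4] -/
theorem mem_pohlmannSets_two_diff_iff (φ₀ : K →+* ℂ) (Φ : CMType K) (hprim : IsPrimitive (ℂ ≃+* ℂ) Φ.1 φ₀)
    (Δ : Finset (K →+* ℂ)) :
    Δ ∈ pohlmannSets Φ 2 \ pohlmannDivisorSets Φ 2 ↔
      Δ.card = 4 ∧ IsGaloisBalanced Φ Δ ∧ ∀ φ ∈ Δ, ComplexEmbedding.conjugate φ ∉ Δ := by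
  have hpairs := mem_pohlmannSets_one_iff_of_isPrimitive φ₀ hprim (Φ := Φ)
  rw [Set.mem_sdiff, pohlmannDivisorSets_eq_of_pairs hpairs 2, mem_pohlmannSets_iff]
  constructor
  · rintro ⟨⟨hcard, hbal⟩, hnot⟩
    refine ⟨by omega, hbal, fun φ hφ hφ' => hnot ⟨⟨hcard, hbal⟩, ?_⟩⟩
    -- `Δ ⊇ {φ, φ̄}` balanced ⟹ the rest is a balanced pair ⟹ `Δ` is conjugation-closed
    intro ψ hψ
    set t : Finset (K →+* ℂ) := {φ, ComplexEmbedding.conjugate φ} with ht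
    have htP : t ∈ pohlmannSets Φ 1 := (hpairs t).2 ⟨φ, rfl⟩
    have htΔ : t ⊆ Δ := by
      intro x hx
      simp only [ht, Finset.mem_insert, Finset.mem_singleton] at hx
      rcases hx with rfl | rfl
      · exact hφ
      · exact hφ'
    have hdisj : Disjoint (Δ \ t) t := Finset.sdiff_disjoint
    have hunion : (Δ \ t).disjUnion t hdisj = Δ := by
      rw [Finset.disjUnion_eq_union, Finset.sdiff_union_of_subset htΔ]
    have hbal' : IsGaloisBalanced Φ ((Δ \ t).disjUnion t hdisj) := by rw [hunion]; exact hbal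
    have hs : IsGaloisBalanced Φ (Δ \ t) := hbal'.of_disjUnion htP.2
    have hscard : (Δ \ t).card = 2 := by
      rw [Finset.card_sdiff_of_subset htΔ, hcard, ht, Finset.card_pair (conjugate_ne_de Φ φ).symm]
    have hsP : Δ \ t ∈ pohlmannSets Φ 1 := ⟨by rw [hscard], hs⟩
    obtain ⟨χ, hχ⟩ := (hpairs _).1 hsP
    by_cases hψt : ψ ∈ t
    · simp only [ht, Finset.mem_insert, Finset.mem_singleton] at hψt
      rcases hψt with rfl | rfl
      · exact hφ'
      · rw [conjugate_conjugate_de]; exact hφ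
    · have hψs : ψ ∈ Δ \ t := Finset.mem_sdiff.2 ⟨hψ, hψt⟩
      rw [hχ, Finset.mem_insert, Finset.mem_singleton] at hψs
      have hmem : ComplexEmbedding.conjugate ψ ∈ Δ \ t := by
        rw [hχ, Finset.mem_insert, Finset.mem_singleton]
        rcases hψs with rfl | rfl
        · exact Or.inr rfl
        · left; exact conjugate_conjugate_de χ
      exact (Finset.mem_sdiff.1 hmem).1
  · rintro ⟨hcard, hbal, hfree⟩
    refine ⟨⟨by rw [hcard], hbal⟩, fun ⟨_, hclosed⟩ => ?_⟩
    obtain ⟨φ, hφ⟩ : Δ.Nonempty := by rw [← Finset.card_pos, hcard]; norm_num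
    exact hfree φ hφ (hclosed φ hφ)

/-- **★★ `[K:ℚ] = 32`, `Φ` PRIMITIVE OF RANK `11`: THE EXCEPTIONAL POHLMANN SETS OF DEGREE `2` ARE EXACTLY THE `24`
COSET-FIBRES of the three Weil CM subfields of degree `8`** (tree g46-#7: the conjugation-free `T_Φ`-balanced `4`-sets
of `Gal(K/ℚ)` are exactly the cosets of the three balanced index-`8` subgroups avoiding `ρ`).
[cite: Pohlmann1968, Thm. 1] [cite: MoonenZarhin1998WeilClasses, Criterion (Q1) and Criterion (Q2)]
[cite: Gordon1999HodgeAVSurvey, §9.2 (9.2.1) and 9.2.2] [cite: Kubota1965, §4 Lemma 2] -/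
theorem pohlmannSets_two_diff_eq_image (hexp : ∀ g : K ≃ₐ[ℚ] K, g ^ 2 = 1) (h32 : finrank ℚ K = 32)
    (φ₀ : K →+* ℂ) (Φ : CMType K) (hprim : IsPrimitive (ℂ ≃+* ℂ) Φ.1 φ₀) (hr : cmTypeRank Φ = 11) :
    pohlmannSets Φ 2 \ pohlmannDivisorSets Φ 2 =
      (fun C : Finset (K ≃ₐ[ℚ] K) => C.image (embOf φ₀)) ''
        {C | ∃ H : Subgroup (K ≃ₐ[ℚ] K), H.index = 8 ∧
          ((conjGal : K ≃ₐ[ℚ] K) ∉ H ∧ ∀ x : K ≃ₐ[ℚ] K, 2 * ((Finset.univ.filter fun s : K ≃ₐ[ℚ] K =>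
            embOf φ₀ s ∈ Φ.1).filter fun t => x * t ∈ H).card = Nat.card H) ∧
          ∃ x₀ : K ≃ₐ[ℚ] K, C = Finset.univ.filter fun t : K ≃ₐ[ℚ] K => x₀ * t ∈ H} := by
  haveI := Multiquadratic.isAbelianGalois_of_forall_sq_eq_one hexp
  have hcard : Fintype.card (K ≃ₐ[ℚ] K) = 32 := by rw [card_gal_eq_finrank φ₀, h32]
  have hrank : typeRank (K ≃ₐ[ℚ] K)
      (↑(Finset.univ.filter fun s : K ≃ₐ[ℚ] K => embOf φ₀ s ∈ Φ.1) : Set (K ≃ₐ[ℚ] K)) = 11 := by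
    rw [← cmTypeRank_eq_typeRank_galType Φ φ₀]; exact hr
  have hT := isCMTypeWith_T_de hexp φ₀ Φ
  rw [← setOf_balanced_four_eq hexp hT hcard hrank]
  have hinj := (embOf_bijective φ₀).1
  ext Δ
  rw [mem_pohlmannSets_two_diff_iff φ₀ Φ hprim, Set.mem_image]
  constructor
  · rintro ⟨hΔ, hbal, hfree⟩
    -- pull `Δ` back to the Galois group
    set D : Finset (K ≃ₐ[ℚ] K) := Finset.univ.filter fun t => embOf φ₀ t ∈ Δ with hD
    have hDimg : D.image (embOf φ₀) = Δ := by
      ext φ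
      simp only [Finset.mem_image, hD, Finset.mem_filter, Finset.mem_univ, true_and]
      constructor
      · rintro ⟨t, ht, rfl⟩; exact ht
      · intro hφ
        obtain ⟨t, rfl⟩ := (embOf_bijective φ₀).2 φ
        exact ⟨t, hφ, rfl⟩
    refine ⟨D, ⟨?_, ?_, ?_⟩, hDimg⟩
    · rw [← Finset.card_image_of_injective D hinj, hDimg, hΔ]
    · intro d hd hd'
      simp only [hD, Finset.mem_filter, Finset.mem_univ, true_and] at hd hd'
      rw [← conjugate_embOf_de hexp φ₀ d] at hd'
      exact hfree _ hd hd'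
    · rw [← hDimg, isGaloisBalanced_image_embOf_iff hexp φ₀ Φ D] at hbal
      exact hbal
  · rintro ⟨D, ⟨hD, hfree, hbal⟩, rfl⟩
    refine ⟨by rw [Finset.card_image_of_injective D hinj, hD], (isGaloisBalanced_image_embOf_iff hexp φ₀ Φ D).2 hbal,
      fun φ hφ hφ' => ?_⟩
    obtain ⟨t, ht, rfl⟩ := Finset.mem_image.1 hφ
    rw [conjugate_embOf_de hexp φ₀ t] at hφ'
    obtain ⟨t', ht', he⟩ := Finset.mem_image.1 hφ'
    rw [hinj he] at ht'
    exact hfree t ht ht'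

/-- **★★ `dim B²(A) − dim D²(A) = 24` EXACTLY** for every abelian `16`-fold of type `(K; Φ)`, `[K:ℚ] = 32`, `Φ`
primitive of rank `11`: the Hodge classes of codimension `2` are spanned (over `ℂ`) by the intersections of divisors
together with EXACTLY `24` further lines — the Weil classes of the three Weil CM subfields of degree `8`.
[cite: Pohlmann1968, Thm. 1] [cite: MoonenZarhin1998WeilClasses, Criterion (Q1) and Criterion (Q2)]
[cite: Gordon1999HodgeAVSurvey, 9.2.2 and 5.13 (ii)] -/
theorem finrank_sub_two_eq_twentyfour (hexp : ∀ g : K ≃ₐ[ℚ] K, g ^ 2 = 1) (h32 : finrank ℚ K = 32)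
    (φ₀ : K →+* ℂ) (Φ : CMType K) (hprim : IsPrimitive (ℂ ≃+* ℂ) Φ.1 φ₀) (hr : cmTypeRank Φ = 11)
    (hA : IsCMTypeRealisation Φ A ι θ) :
    Module.finrank ℂ ↥(hodgeClassSpan (finrank ℚ K / 2) A.X 2) -
        Module.finrank ℂ ↥(divisorClassesSpan A.X (finrank ℚ K / 2) 2) = 24 := by
  haveI := Multiquadratic.isAbelianGalois_of_forall_sq_eq_one hexp
  have hinj : Function.Injective fun C : Finset (K ≃ₐ[ℚ] K) => C.image (embOf φ₀) := by
    intro C₁ C₂ h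
    have h' : (embOf φ₀) '' (↑C₁ : Set (K ≃ₐ[ℚ] K)) = (embOf φ₀) '' ↑C₂ := by
      rw [← Finset.coe_image, ← Finset.coe_image]; exact congrArg _ h
    exact Finset.coe_inj.1 ((embOf_bijective φ₀).1.image_injective h')
  rw [finrank_hodgeClassSpan_sub_finrank_divisorClassesSpan hA 2, pohlmannSets_two_diff_eq_image hexp h32 φ₀ Φ hprim hr,
    Set.ncard_image_of_injective _ hinj, ncard_cosets_eq_index_mul hexp 8,
    ncard_indexEight_balanced_gal_eq_three hexp h32 φ₀ Φ hr]

/-- **★★ EVERY SIMPLE DEGENERATE ABELIAN `16`-FOLD WITH COMPLEX MULTIPLICATION BY A MULTIQUADRATIC CM FIELD OF DEGREE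
`32` HAS `dim B²(A) − dim D²(A) = 24` EXACTLY**: modulo intersections of divisors, its Hodge classes of codimension
`2` are precisely the `24` Weil lines of its three Weil CM subfields of degree `8` — so the Hodge conjecture for `A`
in codimension `2` is EQUIVALENT to the algebraicity of these Weil classes.
[cite: Pohlmann1968, Thm. 1] [cite: MoonenZarhin1998WeilClasses, Criterion (Q1) and Criterion (Q2)]
[cite: Gordon1999HodgeAVSurvey, 9.2.2] [cite: Dodson1984, §3.1.1 Theorem and §3.2.1] -/
theorem finrank_sub_two_eq_twentyfour_of_finrank_eq_thirtytwo (hexp : ∀ g : K ≃ₐ[ℚ] K, g ^ 2 = 1)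
    (h32 : finrank ℚ K = 32) (Φ : CMType K) (hA : IsCMTypeRealisation Φ A ι θ) (hs : A.IsSimple)
    (hnd : ¬ IsNondegenerate Φ) :
    Module.finrank ℂ ↥(hodgeClassSpan (finrank ℚ K / 2) A.X 2) -
        Module.finrank ℂ ↥(divisorClassesSpan A.X (finrank ℚ K / 2) 2) = 24 := by
  obtain ⟨φ₀⟩ := (inferInstance : Nonempty (K →+* ℂ))
  exact finrank_sub_two_eq_twentyfour hexp h32 φ₀ Φ ((isSimple_iff_isPrimitive hA φ₀).1 hs)
    (cmTypeRank_eq_eleven_of_isSimple_of_not_isNondegenerate hexp h32 Φ hA hs hnd) hA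

/-- **EXISTENCE with the exact count** (`[K:ℚ] = 32`): simple CM `16`-folds with `dim B² − dim D² = 24` exist over
every multiquadratic CM field of degree `32`. [cite: Shimura1998, §6.2 Thm. 3] [cite: MoonenZarhin1998WeilClasses, Criterion (Q2)] -/
theorem exists_isSimple_sixteenfold_eq_twentyfour_of_finrank_eq_thirtytwo (hexp : ∀ g : K ≃ₐ[ℚ] K, g ^ 2 = 1)
    (h32 : finrank ℚ K = 32) :
    ∃ (Φ : CMType K) (A : AbelianVariety ℂ) (ι : 𝓞 K →+* End A) (θ : K →+* Module.End ℂ (complexBetti A.X 1)),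
      IsCMTypeRealisation Φ A ι θ ∧ cmTypeRank Φ = 11 ∧ A.IsSimple ∧ A.dim = 16 ∧
        Module.finrank ℂ ↥(hodgeClassSpan (finrank ℚ K / 2) A.X 2) -
          Module.finrank ℂ ↥(divisorClassesSpan A.X (finrank ℚ K / 2) 2) = 24 := by
  obtain ⟨Φ, hr, hnd, -⟩ := exists_isPrimitive_cmTypeRank_eq_eleven hexp h32
  obtain ⟨A, ι, θ, hA⟩ := exists_isCMTypeRealisation Φ
  have hs : A.IsSimple := (isSimple_iff_cmTypeRank_eq_eleven_or_seventeen hexp h32 Φ hA).2 (Or.inl hr)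
  have hdim : A.dim = finrank ℚ K / 2 := Literature.AlgebraicGeometry.Motives.schemeDim_eq_holds hA.1
  exact ⟨Φ, A, ι, θ, hA, hr, hs, by rw [hdim, h32],
    finrank_sub_two_eq_twentyfour_of_finrank_eq_thirtytwo hexp h32 Φ hA hs hnd⟩

end Exact

/-! ## §4 ★★ The exact count in codimension `3`: `dim B³(A) − dim D³(A) = 288` (append, g46-#10) -/

section ExactThree

variable {K : Type} [Field K] [NumberField K] [IsCMField K] [IsGalois ℚ K]
  {A : AbelianVariety ℂ} {ι : 𝓞 K →+* End A} {θ : K →+* Module.End ℂ (complexBetti A.X 1)}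

omit [IsCMField K] in
/-- Pull-back of `Δ ⊆ Hom(K, ℂ)` to the Galois group: `σ({t : σ_t ∈ Δ}) = Δ`. [cite: Shimura1998, §8.1] -/
private theorem image_filter_embOf_eq_de (φ₀ : K →+* ℂ) (Δ : Finset (K →+* ℂ)) :
    (Finset.univ.filter fun t : K ≃ₐ[ℚ] K => embOf φ₀ t ∈ Δ).image (embOf φ₀) = Δ := by
  ext φ
  simp only [Finset.mem_image, Finset.mem_filter, Finset.mem_univ, true_and]
  constructor
  · rintro ⟨t, ht, rfl⟩; exact ht
  · intro hφ
    obtain ⟨t, rfl⟩ := (embOf_bijective φ₀).2 φ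
    exact ⟨t, hφ, rfl⟩

/-- **`[K:ℚ] = 32`, `Φ` primitive of rank `11`: `#(P₂ ∖ PD₂) = 24`** (the `24` coset-fibres; index-set form of
`dim B² − dim D² = 24`). [cite: Pohlmann1968, Thm. 1] [cite: MoonenZarhin1998WeilClasses, Criterion (Q2)] -/
theorem ncard_pohlmannSets_two_diff_eq (hexp : ∀ g : K ≃ₐ[ℚ] K, g ^ 2 = 1) (h32 : finrank ℚ K = 32)
    (φ₀ : K →+* ℂ) (Φ : CMType K) (hprim : IsPrimitive (ℂ ≃+* ℂ) Φ.1 φ₀) (hr : cmTypeRank Φ = 11) :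
    (pohlmannSets Φ 2 \ pohlmannDivisorSets Φ 2).ncard = 24 := by
  haveI := Multiquadratic.isAbelianGalois_of_forall_sq_eq_one hexp
  have hinj : Function.Injective fun C : Finset (K ≃ₐ[ℚ] K) => C.image (embOf φ₀) := by
    intro C₁ C₂ h
    have h' : (embOf φ₀) '' (↑C₁ : Set (K ≃ₐ[ℚ] K)) = (embOf φ₀) '' ↑C₂ := by
      rw [← Finset.coe_image, ← Finset.coe_image]; exact congrArg _ h
    exact Finset.coe_inj.1 ((embOf_bijective φ₀).1.image_injective h')
  rw [pohlmannSets_two_diff_eq_image hexp h32 φ₀ Φ hprim hr, Set.ncard_image_of_injective _ hinj,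
    ncard_cosets_eq_index_mul hexp 8, ncard_indexEight_balanced_gal_eq_three hexp h32 φ₀ Φ hr]

/-- **★ IN CODIMENSION `3` EVERY EXCEPTIONAL POHLMANN SET CONTAINS A CONJUGATE PAIR** (`[K:ℚ] = 32`, `Φ` primitive of
rank `11`): a conjugation-free balanced `6`-set would pull back to a conjugation-free `T_Φ`-balanced `6`-subset of
`Gal(K/ℚ)`, and those have cardinality divisible by `4` (tree g46-#9). [cite: Pohlmann1968, Thm. 1]
[cite: MoonenZarhin1998WeilClasses, Criterion (Q2)] [cite: Gordon1999HodgeAVSurvey, 9.2.2] -/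
theorem exists_pair_of_mem_pohlmannSets_three_diff (hexp : ∀ g : K ≃ₐ[ℚ] K, g ^ 2 = 1) (h32 : finrank ℚ K = 32)
    (φ₀ : K →+* ℂ) (Φ : CMType K) (hr : cmTypeRank Φ = 11) {Δ : Finset (K →+* ℂ)}
    (hΔ : Δ ∈ pohlmannSets Φ 3 \ pohlmannDivisorSets Φ 3) :
    ∃ φ ∈ Δ, ComplexEmbedding.conjugate φ ∈ Δ := by
  haveI := Multiquadratic.isAbelianGalois_of_forall_sq_eq_one hexp
  by_contra hnone
  push Not at hnone
  obtain ⟨⟨hcard, hbal⟩, -⟩ := hΔ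
  have hcardG : Fintype.card (K ≃ₐ[ℚ] K) = 32 := by rw [card_gal_eq_finrank φ₀, h32]
  have hrank : typeRank (K ≃ₐ[ℚ] K)
      (↑(Finset.univ.filter fun s : K ≃ₐ[ℚ] K => embOf φ₀ s ∈ Φ.1) : Set (K ≃ₐ[ℚ] K)) = 11 := by
    rw [← cmTypeRank_eq_typeRank_galType Φ φ₀]; exact hr
  have hT := isCMTypeWith_T_de hexp φ₀ Φ
  set D : Finset (K ≃ₐ[ℚ] K) := Finset.univ.filter fun t => embOf φ₀ t ∈ Δ with hD
  have hDimg : D.image (embOf φ₀) = Δ := image_filter_embOf_eq_de φ₀ Δ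
  have hD6 : D.card = 6 := by
    rw [← Finset.card_image_of_injective D (embOf_bijective φ₀).1, hDimg, hcard]
  have hfree : ∀ d ∈ D, (conjGal : K ≃ₐ[ℚ] K) * d ∉ D := by
    intro d hd hd'
    simp only [hD, Finset.mem_filter, Finset.mem_univ, true_and] at hd hd'
    rw [← conjugate_embOf_de hexp φ₀ d] at hd'
    exact hnone _ hd hd'
  have hbalD := (isGaloisBalanced_image_embOf_iff hexp φ₀ Φ D).1 (by rw [hDimg]; exact hbal)
  exact card_ne_six_of_balanced_free hexp hT hcardG hrank hfree hbalD hD6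

/-- **★★ DECOMPOSITION IN CODIMENSION `3`**: every exceptional Pohlmann set of degree `3` is a Weil `4`-set plus a free
conjugate pair, `Δ = Δ' ⊔ {φ, φ̄}` with `Δ' ∈ P₂ ∖ PD₂`, `φ ∈ Φ`, `φ, φ̄ ∉ Δ'` (`[K:ℚ] = 32`, `Φ` primitive of rank
`11`) — every exceptional Hodge class of codimension `3` on these `16`-folds is, on the index sets, a Weil class of an
octic Weil subfield times a divisor class. [cite: Pohlmann1968, Thm. 1] [cite: MoonenZarhin1998WeilClasses, Criterion (Q2) (proof) and Remark (1)]
[cite: Gordon1999HodgeAVSurvey, 9.2.2] [cite: vanGeemen1994HodgeAV, §2.4] -/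
theorem exists_eq_union_pair_of_mem_pohlmannSets_three_diff (hexp : ∀ g : K ≃ₐ[ℚ] K, g ^ 2 = 1)
    (h32 : finrank ℚ K = 32) (φ₀ : K →+* ℂ) (Φ : CMType K) (hprim : IsPrimitive (ℂ ≃+* ℂ) Φ.1 φ₀)
    (hr : cmTypeRank Φ = 11) {Δ : Finset (K →+* ℂ)} (hΔ : Δ ∈ pohlmannSets Φ 3 \ pohlmannDivisorSets Φ 3) :
    ∃ Δ' ∈ pohlmannSets Φ 2 \ pohlmannDivisorSets Φ 2, ∃ φ : K →+* ℂ, φ ∈ Φ.1 ∧ φ ∉ Δ' ∧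
      ComplexEmbedding.conjugate φ ∉ Δ' ∧ Δ = Δ' ∪ {φ, ComplexEmbedding.conjugate φ} := by
  have hpairs := mem_pohlmannSets_one_iff_of_isPrimitive φ₀ hprim (Φ := Φ)
  obtain ⟨φ₁, hφ₁, hφ₁'⟩ := exists_pair_of_mem_pohlmannSets_three_diff hexp h32 φ₀ Φ hr hΔ
  -- normalise: `φ ∈ Φ`
  obtain ⟨φ, hφΦ, hφ, hφ'⟩ : ∃ φ : K →+* ℂ, φ ∈ Φ.1 ∧ φ ∈ Δ ∧ ComplexEmbedding.conjugate φ ∈ Δ := by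
    by_cases h1 : φ₁ ∈ Φ.1
    · exact ⟨φ₁, h1, hφ₁, hφ₁'⟩
    · refine ⟨ComplexEmbedding.conjugate φ₁, ?_, hφ₁', by rw [conjugate_conjugate_de]; exact hφ₁⟩
      by_contra h2
      exact h1 ((Φ.2 φ₁).2 h2)
  have hΔ' := hΔ
  rw [Set.mem_sdiff, pohlmannDivisorSets_eq_of_pairs hpairs 3, mem_pohlmannSets_iff] at hΔ'
  obtain ⟨⟨hcard, hbal⟩, hnot⟩ := hΔ'
  set t : Finset (K →+* ℂ) := {φ, ComplexEmbedding.conjugate φ} with ht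
  have htP : t ∈ pohlmannSets Φ 1 := (hpairs t).2 ⟨φ, rfl⟩
  have htΔ : t ⊆ Δ := by
    intro x hx
    simp only [ht, Finset.mem_insert, Finset.mem_singleton] at hx
    rcases hx with rfl | rfl
    · exact hφ
    · exact hφ'
  have hdisj : Disjoint (Δ \ t) t := Finset.sdiff_disjoint
  have hunion : (Δ \ t).disjUnion t hdisj = Δ := by
    rw [Finset.disjUnion_eq_union, Finset.sdiff_union_of_subset htΔ]
  have hbal' : IsGaloisBalanced Φ ((Δ \ t).disjUnion t hdisj) := by rw [hunion]; exact hbal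
  have hs : IsGaloisBalanced Φ (Δ \ t) := hbal'.of_disjUnion htP.2
  have hscard : (Δ \ t).card = 4 := by
    rw [Finset.card_sdiff_of_subset htΔ, hcard, ht, Finset.card_pair (conjugate_ne_de Φ φ).symm]
  refine ⟨Δ \ t, ?_, φ, hφΦ, fun h1 => (Finset.mem_sdiff.1 h1).2 (by simp [ht]),
    fun h1 => (Finset.mem_sdiff.1 h1).2 (by simp [ht]), ?_⟩
  · rw [Set.mem_sdiff, pohlmannDivisorSets_eq_of_pairs hpairs 2, mem_pohlmannSets_iff]
    refine ⟨⟨by rw [hscard], hs⟩, fun ⟨_, hclosed⟩ => hnot ⟨⟨hcard, hbal⟩, fun ψ hψ => ?_⟩⟩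
    by_cases hψt : ψ ∈ t
    · simp only [ht, Finset.mem_insert, Finset.mem_singleton] at hψt
      rcases hψt with rfl | rfl
      · exact hφ'
      · rw [conjugate_conjugate_de]; exact hφ
    · exact (Finset.mem_sdiff.1 (hclosed ψ (Finset.mem_sdiff.2 ⟨hψ, hψt⟩))).1
  · rw [Finset.sdiff_union_of_subset htΔ]

/-- **`#(P₃ ∖ PD₃) ≤ 288 = 24 · 12`** (`[K:ℚ] = 32`, `Φ` primitive of rank `11`): the exceptional sets of degree `3`
are images of the pairs (Weil `4`-set, free member of `Φ`). [cite: Pohlmann1968, Thm. 1]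
[cite: MoonenZarhin1998WeilClasses, Criterion (Q2) (proof) and Remark (1)] [cite: Gordon1999HodgeAVSurvey, 9.2.2] -/
theorem ncard_pohlmannSets_three_diff_le (hexp : ∀ g : K ≃ₐ[ℚ] K, g ^ 2 = 1) (h32 : finrank ℚ K = 32)
    (φ₀ : K →+* ℂ) (Φ : CMType K) (hprim : IsPrimitive (ℂ ≃+* ℂ) Φ.1 φ₀) (hr : cmTypeRank Φ = 11) :
    (pohlmannSets Φ 3 \ pohlmannDivisorSets Φ 3).ncard ≤ 288 := by
  -- the parameter set: pairs `(Δ', φ)`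
  have hfin : (pohlmannSets Φ 2 \ pohlmannDivisorSets Φ 2).Finite := Set.toFinite _
  set T₂ : Finset (Finset (K →+* ℂ)) := hfin.toFinset with hT₂
  have hmemT₂ : ∀ {Δ'}, Δ' ∈ T₂ ↔ Δ' ∈ pohlmannSets Φ 2 \ pohlmannDivisorSets Φ 2 := by
    intro Δ'; exact Set.Finite.mem_toFinset hfin
  set free : Finset (K →+* ℂ) → Finset (K →+* ℂ) := fun Δ' =>
    Finset.univ.filter fun φ : K →+* ℂ => φ ∈ Φ.1 ∧ φ ∉ Δ' ∧ ComplexEmbedding.conjugate φ ∉ Δ' with hfree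
  set g : Finset (K →+* ℂ) → Finset (Finset (K →+* ℂ) × (K →+* ℂ)) := fun Δ' =>
    (free Δ').image fun φ => (Δ', φ) with hg
  set S : Finset (Finset (K →+* ℂ) × (K →+* ℂ)) := T₂.biUnion g with hS
  set f : Finset (K →+* ℂ) × (K →+* ℂ) → Finset (K →+* ℂ) := fun p =>
    p.1 ∪ {p.2, ComplexEmbedding.conjugate p.2} with hf
  -- every exceptional `3`-set is an `f`-image
  have hsub : pohlmannSets Φ 3 \ pohlmannDivisorSets Φ 3 ⊆ f '' ↑S := by
    intro Δ hΔ
    obtain ⟨Δ', hΔ', φ, hφΦ, hφ1, hφ2, hΔeq⟩ :=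
      exists_eq_union_pair_of_mem_pohlmannSets_three_diff hexp h32 φ₀ Φ hprim hr hΔ
    refine ⟨(Δ', φ), ?_, hΔeq.symm⟩
    rw [Finset.mem_coe, hS, Finset.mem_biUnion]
    refine ⟨Δ', hmemT₂.2 hΔ', ?_⟩
    simp only [hg, Finset.mem_image]
    refine ⟨φ, ?_, rfl⟩
    simp only [hfree, Finset.mem_filter, Finset.mem_univ, true_and]
    exact ⟨hφΦ, hφ1, hφ2⟩
  -- the parameter set has `24 · 12` elements
  have hdisj : (↑T₂ : Set (Finset (K →+* ℂ))).PairwiseDisjoint g := by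
    intro Δ₁ _ Δ₂ _ hne
    rw [Function.onFun, Finset.disjoint_left]
    intro p hp1 hp2
    simp only [hg, Finset.mem_image] at hp1 hp2
    obtain ⟨φ₁, -, rfl⟩ := hp1
    obtain ⟨φ₂, -, h⟩ := hp2
    exact hne (Prod.mk.inj h).1.symm
  have hcardg : ∀ Δ' ∈ T₂, (g Δ').card = 12 := by
    intro Δ' hΔ'
    obtain ⟨hc4, -, hfreeΔ⟩ := (mem_pohlmannSets_two_diff_iff φ₀ Φ hprim Δ').1 (hmemT₂.1 hΔ')
    rw [hg, Finset.card_image_of_injective _ (fun φ₁ φ₂ h => (Prod.mk.inj h).2)]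
    show (Finset.univ.filter fun φ : K →+* ℂ => φ ∈ Φ.1 ∧ φ ∉ Δ' ∧ ComplexEmbedding.conjugate φ ∉ Δ').card = 12
    rw [card_freeComplement hfreeΔ, hc4, h32]
  have hScard : S.card = 288 := by
    rw [hS, Finset.card_biUnion hdisj, Finset.sum_congr rfl hcardg, Finset.sum_const, smul_eq_mul,
      ← Set.ncard_eq_toFinset_card _ hfin, ncard_pohlmannSets_two_diff_eq hexp h32 φ₀ Φ hprim hr]
  calc (pohlmannSets Φ 3 \ pohlmannDivisorSets Φ 3).ncard ≤ (f '' ↑S).ncard :=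
        Set.ncard_le_ncard hsub (Set.toFinite _)
    _ ≤ (↑S : Set (Finset (K →+* ℂ) × (K →+* ℂ))).ncard := Set.ncard_image_le S.finite_toSet
    _ = 288 := by rw [Set.ncard_coe_finset, hScard]

/-- **★★ `dim B³(A) − dim D³(A) = 288` EXACTLY** for every abelian `16`-fold of type `(K; Φ)`, `[K:ℚ] = 32`, `Φ`
primitive of rank `11`: modulo intersections of divisors the Hodge classes of codimension `3` are exactly the `24 · 12`
products (Weil class of an octic Weil subfield) × (free divisor class). [cite: Pohlmann1968, Thm. 1]
[cite: MoonenZarhin1998WeilClasses, Criterion (Q2) (proof) and Remark (1)] [cite: Gordon1999HodgeAVSurvey, 9.2.2 and 5.13 (ii)] -/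
theorem finrank_sub_three_eq (hexp : ∀ g : K ≃ₐ[ℚ] K, g ^ 2 = 1) (h32 : finrank ℚ K = 32)
    (φ₀ : K →+* ℂ) (Φ : CMType K) (hprim : IsPrimitive (ℂ ≃+* ℂ) Φ.1 φ₀) (hr : cmTypeRank Φ = 11)
    (hA : IsCMTypeRealisation Φ A ι θ) :
    Module.finrank ℂ ↥(hodgeClassSpan (finrank ℚ K / 2) A.X 3) -
        Module.finrank ℂ ↥(divisorClassesSpan A.X (finrank ℚ K / 2) 3) = 288 := by
  refine le_antisymm ?_ ?_
  · rw [finrank_hodgeClassSpan_sub_finrank_divisorClassesSpan hA 3]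
    exact ncard_pohlmannSets_three_diff_le hexp h32 φ₀ Φ hprim hr
  · have h := twentyfour_mul_choose_le_finrank_sub hexp h32 φ₀ Φ hprim hr hA 1
    simpa using h

/-- **★★ EVERY SIMPLE DEGENERATE ABELIAN `16`-FOLD WITH COMPLEX MULTIPLICATION BY A MULTIQUADRATIC CM FIELD OF DEGREE
`32` HAS `dim B³(A) − dim D³(A) = 288` EXACTLY.** [cite: Pohlmann1968, Thm. 1]
[cite: MoonenZarhin1998WeilClasses, Criterion (Q2) (proof) and Remark (1)] [cite: Dodson1984, §3.1.1 Theorem and §3.2.1] -/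
theorem finrank_sub_three_eq_of_finrank_eq_thirtytwo (hexp : ∀ g : K ≃ₐ[ℚ] K, g ^ 2 = 1)
    (h32 : finrank ℚ K = 32) (Φ : CMType K) (hA : IsCMTypeRealisation Φ A ι θ) (hs : A.IsSimple)
    (hnd : ¬ IsNondegenerate Φ) :
    Module.finrank ℂ ↥(hodgeClassSpan (finrank ℚ K / 2) A.X 3) -
        Module.finrank ℂ ↥(divisorClassesSpan A.X (finrank ℚ K / 2) 3) = 288 := by
  obtain ⟨φ₀⟩ := (inferInstance : Nonempty (K →+* ℂ))
  exact finrank_sub_three_eq hexp h32 φ₀ Φ ((isSimple_iff_isPrimitive hA φ₀).1 hs)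
    (cmTypeRank_eq_eleven_of_isSimple_of_not_isNondegenerate hexp h32 Φ hA hs hnd) hA

end ExactThree

/-! ## §5 ★★ Every exceptional Pohlmann set is a disjoint union of Weil `4`-sets and conjugate pairs (append, g46-#12) -/

section Decomposition

variable {K : Type} [Field K] [NumberField K] [IsCMField K] [IsGalois ℚ K]

/-- **★★ THE DECOMPOSITION THEOREM** (`[K:ℚ] = 32`, `Φ` primitive of rank `11`).  Every `Φ`-balanced set
`Δ ⊆ Hom(K, ℂ)` (Pohlmann's condition (9.2.1)) — in particular every member of Pohlmann's basis `pohlmannSets Φ p`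
of `Bᵖ(A) ⊗ ℂ` for the abelian `16`-folds `A` of type `(K; Φ)` — is a DISJOINT UNION of
* exceptional Weil `4`-sets (members of `P₂ ∖ PD₂`: the coset-fibres of the three Weil CM subfields of degree `8`,
  g46-#8), and
* conjugate pairs `{φ, φ̄}` (the balanced pairs `P₁`, indexing the divisor classes).
(Remove the conjugate pairs inside `Δ`; the conjugation-free remainder is balanced, pulls back to a conjugation-free
`T_Φ`-balanced subset of `Gal(K/ℚ)`, which is a disjoint union of cosets of the three balanced index-`8` subgroups by
the tree's classification `exists_cosets_of_balanced_free`, g46-#11.)  Reading (Pohlmann's Thm. 1, Gordon (9.2.1):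
the basis monomial of a disjoint union is the product of the monomials): Pohlmann's basis of `B^•(A) ⊗ ℂ` consists
of products of divisor monomials with the `24` Weil monomials of codimension `2` — so the Hodge conjecture for these
`16`-folds reduces to the algebraicity of the Weil classes of their three octic Weil subfields (this last reading is
the docstring's, not formalized here: the file proves the index-set decomposition).
[cite: Pohlmann1968, Thm. 1] [cite: Gordon1999HodgeAVSurvey, §9.2 (9.2.1) and 9.2.2]
[cite: MoonenZarhin1998WeilClasses, Criterion (Q1) and Criterion (Q2)] [cite: vanGeemen1994HodgeAV, §2.4] -/
theorem exists_decomposition_of_isGaloisBalanced (hexp : ∀ g : K ≃ₐ[ℚ] K, g ^ 2 = 1) (h32 : finrank ℚ K = 32)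
    (φ₀ : K →+* ℂ) (Φ : CMType K) (hprim : IsPrimitive (ℂ ≃+* ℂ) Φ.1 φ₀) (hr : cmTypeRank Φ = 11)
    {Δ : Finset (K →+* ℂ)} (hΔ : IsGaloisBalanced Φ Δ) :
    ∃ 𝒰 : Finset (Finset (K →+* ℂ)),
      (∀ U ∈ 𝒰, U ∈ pohlmannSets Φ 2 \ pohlmannDivisorSets Φ 2 ∨ U ∈ pohlmannSets Φ 1) ∧
      (∀ U ∈ 𝒰, ∀ U' ∈ 𝒰, U ≠ U' → Disjoint U U') ∧ Δ = 𝒰.biUnion id := by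
  haveI := Multiquadratic.isAbelianGalois_of_forall_sq_eq_one hexp
  have hpairs := mem_pohlmannSets_one_iff_of_isPrimitive φ₀ hprim (Φ := Φ)
  have hcardG : Fintype.card (K ≃ₐ[ℚ] K) = 32 := by rw [card_gal_eq_finrank φ₀, h32]
  have hrank : typeRank (K ≃ₐ[ℚ] K)
      (↑(Finset.univ.filter fun s : K ≃ₐ[ℚ] K => embOf φ₀ s ∈ Φ.1) : Set (K ≃ₐ[ℚ] K)) = 11 := by
    rw [← cmTypeRank_eq_typeRank_galType Φ φ₀]; exact hr
  have hT := isCMTypeWith_T_de hexp φ₀ Φ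
  have hinj := (embOf_bijective φ₀).1
  have h16 : finrank ℚ K / 16 = 2 := by rw [h32]
  induction' hn : Δ.card using Nat.strong_induction_on with n ih generalizing Δ
  by_cases hpair : ∃ φ ∈ Δ, ComplexEmbedding.conjugate φ ∈ Δ
  · -- remove one conjugate pair and recurse
    obtain ⟨φ, hφ, hφ'⟩ := hpair
    set t : Finset (K →+* ℂ) := {φ, ComplexEmbedding.conjugate φ} with ht
    have htP : t ∈ pohlmannSets Φ 1 := (hpairs t).2 ⟨φ, rfl⟩
    have htΔ : t ⊆ Δ := by
      intro x hx
      simp only [ht, Finset.mem_insert, Finset.mem_singleton] at hx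
      rcases hx with rfl | rfl
      · exact hφ
      · exact hφ'
    have hdisj : Disjoint (Δ \ t) t := Finset.sdiff_disjoint
    have hunion : (Δ \ t).disjUnion t hdisj = Δ := by
      rw [Finset.disjUnion_eq_union, Finset.sdiff_union_of_subset htΔ]
    have hbal' : IsGaloisBalanced Φ ((Δ \ t).disjUnion t hdisj) := by rw [hunion]; exact hΔ
    have hs : IsGaloisBalanced Φ (Δ \ t) := hbal'.of_disjUnion htP.2
    have hlt : (Δ \ t).card < n := by
      rw [← hn, Finset.card_sdiff_of_subset htΔ, ht, Finset.card_pair (conjugate_ne_de Φ φ).symm]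
      have : 2 ≤ Δ.card := by
        rw [← Finset.card_pair (conjugate_ne_de Φ φ).symm]; exact Finset.card_le_card htΔ
      omega
    obtain ⟨𝒰', h1, h2, h3⟩ := ih _ hlt hs rfl
    have hdisjt : ∀ U ∈ 𝒰', Disjoint t U := by
      intro U hU
      have hUsub : U ⊆ Δ \ t := by rw [h3]; exact Finset.subset_biUnion_of_mem id hU
      exact Finset.disjoint_of_subset_right hUsub Finset.disjoint_sdiff
    refine ⟨insert t 𝒰', ?_, ?_, ?_⟩
    · intro U hU
      rcases Finset.mem_insert.1 hU with rfl | hU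
      · exact Or.inr htP
      · exact h1 U hU
    · intro U hU U' hU' hne
      rcases Finset.mem_insert.1 hU with rfl | hU <;> rcases Finset.mem_insert.1 hU' with rfl | hU'
      · exact absurd rfl hne
      · exact hdisjt U' hU'
      · exact (hdisjt U hU).symm
      · exact h2 U hU U' hU' hne
    · rw [Finset.biUnion_insert, id, ← h3, Finset.union_sdiff_of_subset htΔ]
  · -- conjugation-free: pull back to the Galois group and use the classification
    push Not at hpair
    set D : Finset (K ≃ₐ[ℚ] K) := Finset.univ.filter fun t => embOf φ₀ t ∈ Δ with hD
    have hDimg : D.image (embOf φ₀) = Δ := image_filter_embOf_eq_de φ₀ Δ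
    have hfree : ∀ d ∈ D, (conjGal : K ≃ₐ[ℚ] K) * d ∉ D := by
      intro d hd hd'
      simp only [hD, Finset.mem_filter, Finset.mem_univ, true_and] at hd hd'
      rw [← conjugate_embOf_de hexp φ₀ d] at hd'
      exact hpair _ hd hd'
    have hbalD := (isGaloisBalanced_image_embOf_iff hexp φ₀ Φ D).1 (by rw [hDimg]; exact hΔ)
    obtain ⟨𝒞, h𝒞1, h𝒞2, h𝒞3⟩ := exists_cosets_of_balanced_free hexp hT hcardG hrank D hfree hbalD
    refine ⟨𝒞.image fun C => C.image (embOf φ₀), ?_, ?_, ?_⟩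
    · intro U hU
      obtain ⟨C, hC, rfl⟩ := Finset.mem_image.1 hU
      obtain ⟨H, hH, hρ, hbalH, x₀, rfl⟩ := h𝒞1 C hC
      left
      have := image_coset_mem_pohlmannSets_diff_of_index_eight hexp φ₀ Φ hprim hH hρ hbalH x₀
      rwa [h16] at this
    · intro U hU U' hU' hne
      obtain ⟨C, hC, rfl⟩ := Finset.mem_image.1 hU
      obtain ⟨C', hC', rfl⟩ := Finset.mem_image.1 hU'
      have hCC' : C ≠ C' := fun h => hne (by rw [h])
      exact Finset.disjoint_image hinj |>.2 (h𝒞2 C hC C' hC' hCC')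
    · rw [← hDimg, h𝒞3, Finset.biUnion_image, Finset.image_biUnion]
      rfl

/-- **… in particular for the members of Pohlmann's basis** `pohlmannSets Φ p` (`Bᵖ(A) ⊗ ℂ`), every `p`.
[cite: Pohlmann1968, Thm. 1] [cite: Gordon1999HodgeAVSurvey, §9.2 (9.2.1) and 9.2.2] -/
theorem exists_decomposition_of_mem_pohlmannSets (hexp : ∀ g : K ≃ₐ[ℚ] K, g ^ 2 = 1) (h32 : finrank ℚ K = 32)
    (φ₀ : K →+* ℂ) (Φ : CMType K) (hprim : IsPrimitive (ℂ ≃+* ℂ) Φ.1 φ₀) (hr : cmTypeRank Φ = 11) {p : ℕ}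
    {Δ : Finset (K →+* ℂ)} (hΔ : Δ ∈ pohlmannSets Φ p) :
    ∃ 𝒰 : Finset (Finset (K →+* ℂ)),
      (∀ U ∈ 𝒰, U ∈ pohlmannSets Φ 2 \ pohlmannDivisorSets Φ 2 ∨ U ∈ pohlmannSets Φ 1) ∧
      (∀ U ∈ 𝒰, ∀ U' ∈ 𝒰, U ≠ U' → Disjoint U U') ∧ Δ = 𝒰.biUnion id :=
  exists_decomposition_of_isGaloisBalanced hexp h32 φ₀ Φ hprim hr hΔ.2

/-- **THE SIMPLE DEGENERATE CM `16`-FOLDS**: for the type of a simple degenerate abelian `16`-fold with complex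
multiplication by a multiquadratic CM field of degree `32`, every member of Pohlmann's basis of every `Bᵖ(A) ⊗ ℂ` is
a disjoint union of exceptional Weil `4`-sets (`24` of them, indexing the Weil classes of the three octic Weil subfields
in `H^{2,2}`) and conjugate pairs (indexing divisor classes). [cite: Pohlmann1968, Thm. 1]
[cite: MoonenZarhin1998WeilClasses, Criterion (Q2)] [cite: Gordon1999HodgeAVSurvey, 9.2.2] [cite: Dodson1984, §3.2.1] -/
theorem exists_decomposition_of_isSimple {A : AbelianVariety ℂ} {ι : 𝓞 K →+* End A}
    {θ : K →+* Module.End ℂ (complexBetti A.X 1)} (hexp : ∀ g : K ≃ₐ[ℚ] K, g ^ 2 = 1) (h32 : finrank ℚ K = 32)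
    (Φ : CMType K) (hA : IsCMTypeRealisation Φ A ι θ) (hs : A.IsSimple) (hnd : ¬ IsNondegenerate Φ) {p : ℕ}
    {Δ : Finset (K →+* ℂ)} (hΔ : Δ ∈ pohlmannSets Φ p) :
    ∃ 𝒰 : Finset (Finset (K →+* ℂ)),
      (∀ U ∈ 𝒰, U ∈ pohlmannSets Φ 2 \ pohlmannDivisorSets Φ 2 ∨ U ∈ pohlmannSets Φ 1) ∧
      (∀ U ∈ 𝒰, ∀ U' ∈ 𝒰, U ≠ U' → Disjoint U U') ∧ Δ = 𝒰.biUnion id := by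
  obtain ⟨φ₀⟩ := (inferInstance : Nonempty (K →+* ℂ))
  exact exists_decomposition_of_mem_pohlmannSets hexp h32 φ₀ Φ ((isSimple_iff_isPrimitive hA φ₀).1 hs)
    (cmTypeRank_eq_eleven_of_isSimple_of_not_isNondegenerate hexp h32 Φ hA hs hnd) hΔ

end Decomposition

/-! ## §6 Odd codimension: every exceptional Pohlmann set contains a conjugate pair (append, g46-#13) -/

section Odd

variable {K : Type} [Field K] [NumberField K] [IsCMField K] [IsGalois ℚ K]

/-- **IN ODD CODIMENSION EVERY POHLMANN BASIS SET CONTAINS A CONJUGATE PAIR** (`[K:ℚ] = 32`, `Φ` primitive of rank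
`11`, `p` odd): a disjoint union of Weil `4`-sets and conjugate pairs of cardinality `2p ≡ 2 (mod 4)` contains at least
one pair — on the index sets, every Hodge class monomial of odd codimension on these `16`-folds is divisible by a
divisor monomial (so `Bᵖ ⊗ ℂ ⊆ B¹ · Bᵖ⁻¹` there; g46-#10 is the case `p = 3`). [cite: Pohlmann1968, Thm. 1]
[cite: Gordon1999HodgeAVSurvey, §9.2 (9.2.1) and 9.2.2] [cite: MoonenZarhin1998WeilClasses, Criterion (Q2)] -/
theorem exists_pair_of_mem_pohlmannSets_odd (hexp : ∀ g : K ≃ₐ[ℚ] K, g ^ 2 = 1) (h32 : finrank ℚ K = 32)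
    (φ₀ : K →+* ℂ) (Φ : CMType K) (hprim : IsPrimitive (ℂ ≃+* ℂ) Φ.1 φ₀) (hr : cmTypeRank Φ = 11) {p : ℕ}
    (hp : Odd p) {Δ : Finset (K →+* ℂ)} (hΔ : Δ ∈ pohlmannSets Φ p) :
    ∃ φ ∈ Δ, ComplexEmbedding.conjugate φ ∈ Δ := by
  have hpairs := mem_pohlmannSets_one_iff_of_isPrimitive φ₀ hprim (Φ := Φ)
  obtain ⟨𝒰, h1, h2, h3⟩ := exists_decomposition_of_mem_pohlmannSets hexp h32 φ₀ Φ hprim hr hΔ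
  by_contra hnone
  push Not at hnone
  -- no member of `𝒰` is a pair, so all are `4`-sets
  have hfour : ∀ U ∈ 𝒰, U.card = 4 := by
    intro U hU
    rcases h1 U hU with hW | hP
    · have := hW.1.1; omega
    · exfalso
      obtain ⟨φ, rfl⟩ := (hpairs U).1 hP
      have hφ : φ ∈ Δ := by
        rw [h3, Finset.mem_biUnion]; exact ⟨_, hU, by simp⟩
      have hφ' : ComplexEmbedding.conjugate φ ∈ Δ := by
        rw [h3, Finset.mem_biUnion]; exact ⟨_, hU, by simp⟩
      exact hnone φ hφ hφ'
  have hcard : Δ.card = 4 * 𝒰.card := by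
    have hdisj : (↑𝒰 : Set (Finset (K →+* ℂ))).PairwiseDisjoint id := fun U hU U' hU' hne => h2 U hU U' hU' hne
    rw [h3, Finset.card_biUnion hdisj]
    rw [Finset.sum_congr rfl fun U hU => show (id U).card = 4 from hfour U hU, Finset.sum_const, smul_eq_mul,
      mul_comm]
  rw [hΔ.1] at hcard
  obtain ⟨k, hk⟩ := hp
  omega

/-- **… on every simple degenerate CM `16`-fold** (multiquadratic complex multiplication of degree `32`), odd `p`.
[cite: Pohlmann1968, Thm. 1] [cite: Gordon1999HodgeAVSurvey, 9.2.2] [cite: Dodson1984, §3.2.1] -/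
theorem exists_pair_of_mem_pohlmannSets_odd_of_isSimple {A : AbelianVariety ℂ} {ι : 𝓞 K →+* End A}
    {θ : K →+* Module.End ℂ (complexBetti A.X 1)} (hexp : ∀ g : K ≃ₐ[ℚ] K, g ^ 2 = 1) (h32 : finrank ℚ K = 32)
    (Φ : CMType K) (hA : IsCMTypeRealisation Φ A ι θ) (hs : A.IsSimple) (hnd : ¬ IsNondegenerate Φ) {p : ℕ}
    (hp : Odd p) {Δ : Finset (K →+* ℂ)} (hΔ : Δ ∈ pohlmannSets Φ p) :
    ∃ φ ∈ Δ, ComplexEmbedding.conjugate φ ∈ Δ := by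
  obtain ⟨φ₀⟩ := (inferInstance : Nonempty (K →+* ℂ))
  exact exists_pair_of_mem_pohlmannSets_odd hexp h32 φ₀ Φ ((isSimple_iff_isPrimitive hA φ₀).1 hs)
    (cmTypeRank_eq_eleven_of_isSimple_of_not_isNondegenerate hexp h32 Φ hA hs hnd) hp hΔ

end Odd

/-! ## §7 The Weil CM subfields: degrees `2, 4, 8` only — exactly `6 + 15 + 3 = 24` (append, g46-#16) -/

section AllDegrees

variable {K : Type} [Field K] [NumberField K] [IsCMField K] [IsGalois ℚ K]

/-- **A WEIL CM SUBFIELD HAS DEGREE AT MOST `8`** (`[K:ℚ] = 32`, rank `11`): if `L ⊆ K` is not totally real and `Φ`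
is balanced over `L` (`n_σ(Φ) = n_σ̄(Φ)` for all `σ : L → ℂ`), then `[L:ℚ] ≤ 8` — group level
`index_le_eight_of_balanced` (g46-#15: no Weil subgroups of index `16`, `32`). [cite: MoonenZarhin1998WeilClasses, Criterion (Q1)]
[cite: Dodson1984, §3.1.1 Theorem] [cite: Shimura1998, §8.1] -/
theorem finrank_le_eight_of_weil (hexp : ∀ g : K ≃ₐ[ℚ] K, g ^ 2 = 1) (h32 : finrank ℚ K = 32) (Φ : CMType K)
    (hr : cmTypeRank Φ = 11) {L : IntermediateField ℚ K} (hL : ¬ IsTotallyReal L)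
    (hbal : ∀ σ : L →+* ℂ, {φ : K →+* ℂ | φ.comp (algebraMap L K) = σ ∧ φ ∈ Φ.1}.ncard =
      {φ : K →+* ℂ | φ.comp (algebraMap L K) = σ ∧ φ ∉ Φ.1}.ncard) :
    finrank ℚ L ≤ 8 := by
  haveI := Multiquadratic.isAbelianGalois_of_forall_sq_eq_one hexp
  obtain ⟨φ₀⟩ := (inferInstance : Nonempty (K →+* ℂ))
  have hcardG : Fintype.card (K ≃ₐ[ℚ] K) = 32 := by rw [card_gal_eq_finrank φ₀, h32]
  have hrank : typeRank (K ≃ₐ[ℚ] K)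
      (↑(Finset.univ.filter fun s : K ≃ₐ[ℚ] K => embOf φ₀ s ∈ Φ.1) : Set (K ≃ₐ[ℚ] K)) = 11 := by
    rw [← cmTypeRank_eq_typeRank_galType Φ φ₀]; exact hr
  have hT := isCMTypeWith_T_de hexp φ₀ Φ
  rw [← index_fixingSubgroup_eq_finrank L]
  exact index_le_eight_of_balanced hexp hT hcardG hrank ((conjGal_not_mem_fixingSubgroup_iff L).2 hL)
    ((forall_fibre_iff_forall_coset hexp φ₀ Φ L).1 hbal)

/-- **… so its degree is `2`, `4` or `8`.** [cite: MoonenZarhin1998WeilClasses, Criterion (Q1)] [cite: Shimura1998, §8.1] -/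
theorem finrank_eq_or_of_weil (hexp : ∀ g : K ≃ₐ[ℚ] K, g ^ 2 = 1) (h32 : finrank ℚ K = 32) (Φ : CMType K)
    (hr : cmTypeRank Φ = 11) {L : IntermediateField ℚ K} (hL : ¬ IsTotallyReal L)
    (hbal : ∀ σ : L →+* ℂ, {φ : K →+* ℂ | φ.comp (algebraMap L K) = σ ∧ φ ∈ Φ.1}.ncard =
      {φ : K →+* ℂ | φ.comp (algebraMap L K) = σ ∧ φ ∉ Φ.1}.ncard) :
    finrank ℚ L = 2 ∨ finrank ℚ L = 4 ∨ finrank ℚ L = 8 := by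
  have h8 := finrank_le_eight_of_weil hexp h32 Φ hr hL hbal
  have hdvd : finrank ℚ L ∣ 32 := by
    rw [← h32]; exact ⟨finrank L K, (Module.finrank_mul_finrank ℚ L K).symm⟩
  have h1 : finrank ℚ L ≠ 1 := by
    intro h1
    have hidx : L.fixingSubgroup.index = 1 := by rw [index_fixingSubgroup_eq_finrank L, h1]
    have htop := Subgroup.index_eq_one.1 hidx
    exact (conjGal_not_mem_fixingSubgroup_iff L).2 hL (htop ▸ Subgroup.mem_top _)
  obtain ⟨k, hk, hk'⟩ := (Nat.dvd_prime_pow Nat.prime_two).1 (show finrank ℚ L ∣ 2 ^ 5 by norm_num; exact hdvd)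
  rw [hk'] at h8 h1 ⊢
  interval_cases k <;> simp_all

/-- **★ EXACTLY `24` WEIL CM SUBFIELDS: `6` imaginary quadratic, `15` of degree `4`, `3` of degree `8`, none beyond**
(`[K:ℚ] = 32` multiquadratic, `Φ` of rank `11` — e.g. every simple degenerate CM `16`-fold): `#{L ⊆ K : L not totally
real, Φ balanced over L} = ([K:ℚ]/2 + 1 − Rank) + C(6, 2) + 3 = 24` (tree `cmTypeRank_add_ncard_weilQuadratic_eq`,
g46-#2 `ncard_weilBiquadratic_eq_fifteen`, g46-#6 `ncard_weilOctic_eq_three`, and §7's degree bound) — as many as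
there are exceptional Weil `4`-sets in codimension `2` (§4).
[cite: MoonenZarhin1998WeilClasses, Criterion (Q1) and Criterion (Q2)] [cite: Gordon1999HodgeAVSurvey, 9.4.3 and 5.13 (ii)]
[cite: Dodson1984, §3.1.1 Theorem] -/
theorem ncard_weilSubfields_eq_twentyfour (hexp : ∀ g : K ≃ₐ[ℚ] K, g ^ 2 = 1) (h32 : finrank ℚ K = 32)
    (Φ : CMType K) (hr : cmTypeRank Φ = 11) :
    {L : IntermediateField ℚ K | ¬ IsTotallyReal L ∧
      ∀ σ : L →+* ℂ, {φ : K →+* ℂ | φ.comp (algebraMap L K) = σ ∧ φ ∈ Φ.1}.ncard =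
        {φ : K →+* ℂ | φ.comp (algebraMap L K) = σ ∧ φ ∉ Φ.1}.ncard}.ncard = 24 := by
  set W : IntermediateField ℚ K → Prop := fun L => ¬ IsTotallyReal L ∧
    ∀ σ : L →+* ℂ, {φ : K →+* ℂ | φ.comp (algebraMap L K) = σ ∧ φ ∈ Φ.1}.ncard =
      {φ : K →+* ℂ | φ.comp (algebraMap L K) = σ ∧ φ ∉ Φ.1}.ncard with hW
  have hS : ∀ d : ℕ, {L : IntermediateField ℚ K | finrank ℚ L = d ∧ ¬ IsTotallyReal L ∧
      ∀ σ : L →+* ℂ, {φ : K →+* ℂ | φ.comp (algebraMap L K) = σ ∧ φ ∈ Φ.1}.ncard =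
        {φ : K →+* ℂ | φ.comp (algebraMap L K) = σ ∧ φ ∉ Φ.1}.ncard} =
      {L : IntermediateField ℚ K | finrank ℚ L = d ∧ W L} := by
    intro d; rfl
  have h2 : {L : IntermediateField ℚ K | finrank ℚ L = 2 ∧ W L}.ncard = 6 := by
    have := cmTypeRank_add_ncard_weilQuadratic_eq hexp Φ
    rw [hS 2, hr, h32] at this
    omega
  have h4 : {L : IntermediateField ℚ K | finrank ℚ L = 4 ∧ W L}.ncard = 15 := by
    rw [← hS 4]; exact ncard_weilBiquadratic_eq_fifteen hexp h32 Φ hr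
  have h8 : {L : IntermediateField ℚ K | finrank ℚ L = 8 ∧ W L}.ncard = 3 := by
    rw [← hS 8]; exact ncard_weilOctic_eq_three hexp h32 Φ hr
  haveI : Finite (IntermediateField ℚ K) := Finite.of_injective _ fixingSubgroup_injective_de
  have hfin : ∀ s : Set (IntermediateField ℚ K), s.Finite := fun s => Set.toFinite s
  have heq : {L : IntermediateField ℚ K | W L} = ({L : IntermediateField ℚ K | finrank ℚ L = 2 ∧ W L} ∪
      {L : IntermediateField ℚ K | finrank ℚ L = 4 ∧ W L}) ∪ {L : IntermediateField ℚ K | finrank ℚ L = 8 ∧ W L} := by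
    ext L
    simp only [Set.mem_setOf_eq, Set.mem_union]
    constructor
    · intro hL
      rcases finrank_eq_or_of_weil hexp h32 Φ hr hL.1 hL.2 with h | h | h
      · exact Or.inl (Or.inl ⟨h, hL⟩)
      · exact Or.inl (Or.inr ⟨h, hL⟩)
      · exact Or.inr ⟨h, hL⟩
    · rintro ((⟨-, hL⟩ | ⟨-, hL⟩) | ⟨-, hL⟩) <;> exact hL
  have hd24 : Disjoint {L : IntermediateField ℚ K | finrank ℚ L = 2 ∧ W L}
      {L : IntermediateField ℚ K | finrank ℚ L = 4 ∧ W L} :=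
    Set.disjoint_left.2 fun L h1 h2 => by have := h1.1; have := h2.1; omega
  have hd8 : Disjoint ({L : IntermediateField ℚ K | finrank ℚ L = 2 ∧ W L} ∪
      {L : IntermediateField ℚ K | finrank ℚ L = 4 ∧ W L}) {L : IntermediateField ℚ K | finrank ℚ L = 8 ∧ W L} :=
    Set.disjoint_left.2 fun L h1 h2 => by
      have := h2.1
      rcases h1 with h1 | h1 <;> have := h1.1 <;> omega
  show {L : IntermediateField ℚ K | W L}.ncard = 24
  rw [heq, Set.ncard_union_eq hd8 (hfin _) (hfin _), Set.ncard_union_eq hd24 (hfin _) (hfin _), h2, h4, h8]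

/-- **… for every simple degenerate abelian `16`-fold with complex multiplication by a multiquadratic CM field of
degree `32`: exactly `24` Weil CM subfields.** [cite: MoonenZarhin1998WeilClasses, Criterion (Q2)]
[cite: Dodson1984, §3.2.1] [cite: Gordon1999HodgeAVSurvey, 9.4.3] -/
theorem ncard_weilSubfields_eq_twentyfour_of_isSimple {A : AbelianVariety ℂ} {ι : 𝓞 K →+* End A}
    {θ : K →+* Module.End ℂ (complexBetti A.X 1)} (hexp : ∀ g : K ≃ₐ[ℚ] K, g ^ 2 = 1) (h32 : finrank ℚ K = 32)
    (Φ : CMType K) (hA : IsCMTypeRealisation Φ A ι θ) (hs : A.IsSimple) (hnd : ¬ IsNondegenerate Φ) :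
    {L : IntermediateField ℚ K | ¬ IsTotallyReal L ∧
      ∀ σ : L →+* ℂ, {φ : K →+* ℂ | φ.comp (algebraMap L K) = σ ∧ φ ∈ Φ.1}.ncard =
        {φ : K →+* ℂ | φ.comp (algebraMap L K) = σ ∧ φ ∉ Φ.1}.ncard}.ncard = 24 :=
  ncard_weilSubfields_eq_twentyfour hexp h32 Φ (cmTypeRank_eq_eleven_of_isSimple_of_not_isNondegenerate hexp h32 Φ
    hA hs hnd)

end AllDegrees

/-! ## §8 Where the exceptional classes are: exactly the codimensions `2 ≤ p ≤ 14` (append, g46-#17) -/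

section Range

variable {K : Type} [Field K] [NumberField K] [IsCMField K] [IsGalois ℚ K]
  {A : AbelianVariety ℂ} {ι : 𝓞 K →+* End A} {θ : K →+* Module.End ℂ (complexBetti A.X 1)}

omit [IsGalois ℚ K] in
/-- `|T_Φ| = [K:ℚ]/2` on the Galois group (`T_Φ ⊔ ρT_Φ = G`). [cite: Shimura1998, §8.1] [cite: Dodson1984, §3.1.1] -/
private theorem two_mul_card_T_de [IsGalois ℚ K] (hexp : ∀ g : K ≃ₐ[ℚ] K, g ^ 2 = 1) (φ₀ : K →+* ℂ)
    (Φ : CMType K) :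
    2 * (Finset.univ.filter fun s : K ≃ₐ[ℚ] K => embOf φ₀ s ∈ Φ.1).card = Fintype.card (K ≃ₐ[ℚ] K) := by
  haveI := Multiquadratic.isAbelianGalois_of_forall_sq_eq_one hexp
  have hT := isCMTypeWith_T_de hexp φ₀ Φ
  set T := Finset.univ.filter fun s : K ≃ₐ[ℚ] K => embOf φ₀ s ∈ Φ.1 with hTdef
  have hmem : ∀ x : K ≃ₐ[ℚ] K, x ∈ T ↔ conjGal * x ∉ T := fun x => by
    have := hT.mem_iff x
    simpa only [Finset.mem_coe, smul_eq_mul] using this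
  have hρ2 : (conjGal : K ≃ₐ[ℚ] K) * conjGal = 1 := by
    have := hexp conjGal; rwa [pow_two] at this
  have hinj : Function.Injective fun s : K ≃ₐ[ℚ] K => conjGal * s := fun a b hab => mul_left_cancel hab
  have hc : Tᶜ = T.image fun s => conjGal * s := by
    ext x
    rw [Finset.mem_compl, Finset.mem_image]
    constructor
    · intro hx
      refine ⟨conjGal * x, ?_, by rw [← mul_assoc, hρ2, one_mul]⟩
      by_contra h1
      exact hx (by rw [hmem, ← mul_assoc, hρ2, one_mul] at h1; push Not at h1; exact h1)
    · rintro ⟨s, hs, rfl⟩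
      exact (hmem s).1 hs
  have h1 := Finset.card_compl_add_card T
  rw [hc, Finset.card_image_of_injective _ hinj] at h1
  omega

/-- **The complement of a balanced set is balanced** (`Hom(K, ℂ)` itself is balanced: `|τΦ| = |τΦ̄|`).
[cite: Gordon1999HodgeAVSurvey, §9.2 (9.2.1)] [cite: Pohlmann1968, Thm. 1] -/
theorem isGaloisBalanced_univ_sdiff (hexp : ∀ g : K ≃ₐ[ℚ] K, g ^ 2 = 1) (φ₀ : K →+* ℂ) {Φ : CMType K}
    {Δ : Finset (K →+* ℂ)} (hΔ : IsGaloisBalanced Φ Δ) : IsGaloisBalanced Φ (Finset.univ \ Δ) := by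
  haveI := Multiquadratic.isAbelianGalois_of_forall_sq_eq_one hexp
  have hinj := (embOf_bijective φ₀).1
  set T := Finset.univ.filter fun s : K ≃ₐ[ℚ] K => embOf φ₀ s ∈ Φ.1 with hTdef
  set D : Finset (K ≃ₐ[ℚ] K) := Finset.univ.filter fun t => embOf φ₀ t ∈ Δ with hD
  have hDimg : D.image (embOf φ₀) = Δ := image_filter_embOf_eq_de φ₀ Δ
  have hcimg : (Finset.univ \ D).image (embOf φ₀) = Finset.univ \ Δ := by
    rw [Finset.image_sdiff_of_injOn hinj.injOn (Finset.subset_univ _), hDimg,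
      Finset.image_univ_of_surjective (embOf_bijective φ₀).2]
  have hbalD := (isGaloisBalanced_image_embOf_iff hexp φ₀ Φ D).1 (by rw [hDimg]; exact hΔ)
  rw [← hcimg, isGaloisBalanced_image_embOf_iff hexp φ₀ Φ]
  intro x
  have hTx : (Finset.univ.filter fun t : K ≃ₐ[ℚ] K => x * t ∈ T).card = T.card := by
    refine Finset.card_bij (fun t _ => x * t) (fun t ht => (Finset.mem_filter.1 ht).2)
      (fun a _ b _ hab => mul_left_cancel hab) fun s hs => ⟨x * s, ?_, ?_⟩
    · rw [Finset.mem_filter, ← mul_assoc, mul_self_de hexp, one_mul]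
      exact ⟨Finset.mem_univ _, hs⟩
    · rw [← mul_assoc, mul_self_de hexp, one_mul]
  have hsplit : ((Finset.univ \ D).filter fun t => x * t ∈ T) =
      (Finset.univ.filter fun t : K ≃ₐ[ℚ] K => x * t ∈ T) \ D.filter fun t => x * t ∈ T := by
    ext t; simp only [Finset.mem_filter, Finset.mem_sdiff, Finset.mem_univ, true_and]; tauto
  have hsub : (D.filter fun t => x * t ∈ T) ⊆ Finset.univ.filter fun t : K ≃ₐ[ℚ] K => x * t ∈ T :=
    Finset.filter_subset_filter _ (Finset.subset_univ D)
  rw [hsplit, Finset.card_sdiff_of_subset hsub, hTx, Finset.card_sdiff_of_subset (Finset.subset_univ D),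
    Finset.card_univ]
  have h2T := two_mul_card_T_de hexp φ₀ Φ
  have hx := hbalD x
  rw [← hTdef] at h2T hx
  have := Finset.card_le_card hsub
  have := Finset.card_le_univ D
  omega

/-- **`P₁₅ = PD₁₅`: NO EXCEPTIONAL CLASSES IN CODIMENSION `15`** (`[K:ℚ] = 32`, `Φ` primitive): the complement of a
balanced `30`-set is a balanced pair, hence a conjugate pair, so the set is closed under conjugation.
[cite: Pohlmann1968, Thm. 1] [cite: Gordon1999HodgeAVSurvey, 9.2.2] -/
theorem pohlmannSets_fifteen_subset (hexp : ∀ g : K ≃ₐ[ℚ] K, g ^ 2 = 1) (h32 : finrank ℚ K = 32)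
    (φ₀ : K →+* ℂ) (Φ : CMType K) (hprim : IsPrimitive (ℂ ≃+* ℂ) Φ.1 φ₀) :
    pohlmannSets Φ 15 ⊆ pohlmannDivisorSets Φ 15 := by
  have hpairs := mem_pohlmannSets_one_iff_of_isPrimitive φ₀ hprim (Φ := Φ)
  intro Δ hΔ
  obtain ⟨hcard, hbal⟩ := hΔ
  have huniv : (Finset.univ : Finset (K →+* ℂ)).card = 32 := by
    rw [Finset.card_univ, NumberField.Embeddings.card, h32]
  have hc2 : (Finset.univ \ Δ).card = 2 := by
    rw [Finset.card_sdiff_of_subset (Finset.subset_univ Δ), huniv, hcard]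
  have hP1 : Finset.univ \ Δ ∈ pohlmannSets Φ 1 := ⟨by rw [hc2], isGaloisBalanced_univ_sdiff hexp φ₀ hbal⟩
  obtain ⟨φ, hφ⟩ := (hpairs _).1 hP1
  rw [pohlmannDivisorSets_eq_of_pairs hpairs 15]
  refine ⟨⟨hcard, hbal⟩, fun ψ hψ => ?_⟩
  by_contra hψ'
  have hmem : ComplexEmbedding.conjugate ψ ∈ Finset.univ \ Δ := Finset.mem_sdiff.2 ⟨Finset.mem_univ _, hψ'⟩
  rw [hφ, Finset.mem_insert, Finset.mem_singleton] at hmem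
  have hψc : ψ ∈ Finset.univ \ Δ := by
    rw [hφ, Finset.mem_insert, Finset.mem_singleton]
    rcases hmem with h1 | h1
    · right; rw [← h1, conjugate_conjugate_de]
    · left
      have := congrArg ComplexEmbedding.conjugate h1
      rwa [conjugate_conjugate_de, conjugate_conjugate_de] at this
  exact (Finset.mem_sdiff.1 hψc).2 hψ

/-- **★ WHERE THE EXCEPTIONAL CLASSES ARE** for an abelian `16`-fold of type `(K; Φ)`, `[K:ℚ] = 32`, `Φ` primitive
of rank `11` (every simple degenerate CM `16`-fold with multiquadratic complex multiplication of degree `32`):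
**`Bᵖ(A) ≠ Dᵖ(A)` exactly for `2 ≤ p ≤ 14`** — `⟸` by the `24·C(12, p − 2) ≥ 24` exceptional sets of §2, `⟹`
because `P₀, P₁, P₁₅, P₁₆` consist of conjugation-closed sets and `P_p = ∅` for `p > 16`.
[cite: Pohlmann1968, Thm. 1] [cite: Gordon1999HodgeAVSurvey, 9.2.2 and 5.13 (ii)]
[cite: MoonenZarhin1998WeilClasses, Criterion (Q2)] -/
theorem finrank_sub_pos_iff (hexp : ∀ g : K ≃ₐ[ℚ] K, g ^ 2 = 1) (h32 : finrank ℚ K = 32) (φ₀ : K →+* ℂ)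
    (Φ : CMType K) (hprim : IsPrimitive (ℂ ≃+* ℂ) Φ.1 φ₀) (hr : cmTypeRank Φ = 11)
    (hA : IsCMTypeRealisation Φ A ι θ) (p : ℕ) :
    0 < Module.finrank ℂ ↥(hodgeClassSpan (finrank ℚ K / 2) A.X p) -
        Module.finrank ℂ ↥(divisorClassesSpan A.X (finrank ℚ K / 2) p) ↔ 2 ≤ p ∧ p ≤ 14 := by
  have hpairs := mem_pohlmannSets_one_iff_of_isPrimitive φ₀ hprim (Φ := Φ)
  constructor
  · intro hpos
    rw [finrank_hodgeClassSpan_sub_finrank_divisorClassesSpan hA p, Set.ncard_pos (Set.toFinite _)] at hpos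
    obtain ⟨Δ, hΔP, hΔD⟩ := hpos
    have huniv : (Finset.univ : Finset (K →+* ℂ)).card = 32 := by
      rw [Finset.card_univ, NumberField.Embeddings.card, h32]
    have hle : Δ.card ≤ 32 := huniv ▸ Finset.card_le_univ Δ
    have hcard := hΔP.1
    by_contra hnot
    have hp : p ≤ 1 ∨ p = 15 ∨ p = 16 := by omega
    apply hΔD
    rcases hp with hp | rfl | rfl
    · -- `p ≤ 1`: members of `P₀ = {∅}` and `P₁` (pairs) are conjugation-closed
      rw [pohlmannDivisorSets_eq_of_pairs hpairs p]
      refine ⟨hΔP, fun ψ hψ => ?_⟩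
      interval_cases p
      · rw [mul_zero, Finset.card_eq_zero] at hcard
        rw [hcard] at hψ; exact absurd hψ (Finset.notMem_empty ψ)
      · obtain ⟨φ, hφ⟩ := (hpairs Δ).1 hΔP
        rw [hφ, Finset.mem_insert, Finset.mem_singleton] at hψ ⊢
        rcases hψ with rfl | rfl
        · exact Or.inr rfl
        · exact Or.inl (conjugate_conjugate_de φ)
    · exact pohlmannSets_fifteen_subset hexp h32 φ₀ Φ hprim hΔP
    · -- `p = 16`: `Δ = Hom(K, ℂ)`
      have hΔ : Δ = Finset.univ := Finset.eq_univ_of_card Δ (by rw [hcard, ← Finset.card_univ, huniv])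
      rw [pohlmannDivisorSets_eq_of_pairs hpairs 16]
      exact ⟨hΔP, fun ψ _ => hΔ ▸ Finset.mem_univ _⟩
  · rintro ⟨h2, h14⟩
    obtain ⟨j, rfl⟩ : ∃ j, p = 2 + j := ⟨p - 2, by omega⟩
    have h := twentyfour_mul_choose_le_finrank_sub hexp h32 φ₀ Φ hprim hr hA j
    have hj : 0 < Nat.choose 12 j := Nat.choose_pos (by omega)
    omega

/-- **… for the simple degenerate CM `16`-folds: exceptional Hodge classes in codimension `p` iff `2 ≤ p ≤ 14`.**
[cite: Pohlmann1968, Thm. 1] [cite: Gordon1999HodgeAVSurvey, 9.2.2] [cite: Dodson1984, §3.2.1] -/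
theorem finrank_sub_pos_iff_of_isSimple (hexp : ∀ g : K ≃ₐ[ℚ] K, g ^ 2 = 1) (h32 : finrank ℚ K = 32)
    (Φ : CMType K) (hA : IsCMTypeRealisation Φ A ι θ) (hs : A.IsSimple) (hnd : ¬ IsNondegenerate Φ) (p : ℕ) :
    0 < Module.finrank ℂ ↥(hodgeClassSpan (finrank ℚ K / 2) A.X p) -
        Module.finrank ℂ ↥(divisorClassesSpan A.X (finrank ℚ K / 2) p) ↔ 2 ≤ p ∧ p ≤ 14 := by
  obtain ⟨φ₀⟩ := (inferInstance : Nonempty (K →+* ℂ))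
  exact finrank_sub_pos_iff hexp h32 φ₀ Φ ((isSimple_iff_isPrimitive hA φ₀).1 hs)
    (cmTypeRank_eq_eleven_of_isSimple_of_not_isNondegenerate hexp h32 Φ hA hs hnd) hA p

end Range

/-! ## §9 The symmetry `p ↔ 16 − p`: complements; exact counts in codimensions `13`, `14` (append, g46-#17) -/

section Symmetry

variable {K : Type} [Field K] [NumberField K] [IsCMField K] [IsGalois ℚ K]
  {A : AbelianVariety ℂ} {ι : 𝓞 K →+* End A} {θ : K →+* Module.End ℂ (complexBetti A.X 1)}

/-- **Complementation maps the exceptional sets of degree `p` onto those of degree `16 − p`** (`[K:ℚ] = 32`, `Φ`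
primitive): `Δ ↦ Hom(K, ℂ) ∖ Δ` preserves balancedness (§8) and closure under conjugation, in both directions.
[cite: Pohlmann1968, Thm. 1] [cite: Gordon1999HodgeAVSurvey, §9.2 (9.2.1) and 9.2.2] -/
theorem univ_sdiff_mem_diff (hexp : ∀ g : K ≃ₐ[ℚ] K, g ^ 2 = 1) (h32 : finrank ℚ K = 32) (φ₀ : K →+* ℂ)
    (Φ : CMType K) (hprim : IsPrimitive (ℂ ≃+* ℂ) Φ.1 φ₀) {p : ℕ} (hp : p ≤ 16) {Δ : Finset (K →+* ℂ)}
    (hΔ : Δ ∈ pohlmannSets Φ p \ pohlmannDivisorSets Φ p) :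
    Finset.univ \ Δ ∈ pohlmannSets Φ (16 - p) \ pohlmannDivisorSets Φ (16 - p) := by
  have hpairs := mem_pohlmannSets_one_iff_of_isPrimitive φ₀ hprim (Φ := Φ)
  have huniv : (Finset.univ : Finset (K →+* ℂ)).card = 32 := by
    rw [Finset.card_univ, NumberField.Embeddings.card, h32]
  rw [Set.mem_sdiff, pohlmannDivisorSets_eq_of_pairs hpairs] at hΔ ⊢
  obtain ⟨⟨hcard, hbal⟩, hnot⟩ := hΔ
  have hP : Finset.univ \ Δ ∈ pohlmannSets Φ (16 - p) :=
    ⟨by rw [Finset.card_sdiff_of_subset (Finset.subset_univ Δ), huniv, hcard]; omega,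
      isGaloisBalanced_univ_sdiff hexp φ₀ hbal⟩
  refine ⟨hP, fun ⟨_, hclosed⟩ => hnot ⟨⟨hcard, hbal⟩, fun ψ hψ => ?_⟩⟩
  by_contra hψ'
  have h1 := hclosed _ (Finset.mem_sdiff.2 ⟨Finset.mem_univ _, hψ'⟩)
  rw [conjugate_conjugate_de] at h1
  exact (Finset.mem_sdiff.1 h1).2 hψ

/-- **`#(P_p ∖ PD_p) = #(P_{16−p} ∖ PD_{16−p})`** (`[K:ℚ] = 32`, `Φ` primitive, `p ≤ 16`): the numbers of
exceptional Hodge classes of complementary codimensions agree (complementation is an involution).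
[cite: Pohlmann1968, Thm. 1] [cite: Gordon1999HodgeAVSurvey, 9.2.2] -/
theorem ncard_diff_eq_ncard_diff_sub (hexp : ∀ g : K ≃ₐ[ℚ] K, g ^ 2 = 1) (h32 : finrank ℚ K = 32)
    (φ₀ : K →+* ℂ) (Φ : CMType K) (hprim : IsPrimitive (ℂ ≃+* ℂ) Φ.1 φ₀) {p : ℕ} (hp : p ≤ 16) :
    (pohlmannSets Φ p \ pohlmannDivisorSets Φ p).ncard =
      (pohlmannSets Φ (16 - p) \ pohlmannDivisorSets Φ (16 - p)).ncard := by
  set c : Finset (K →+* ℂ) → Finset (K →+* ℂ) := fun Δ => Finset.univ \ Δ with hc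
  have hcc : ∀ Δ : Finset (K →+* ℂ), c (c Δ) = Δ := fun Δ => by
    show Finset.univ \ (Finset.univ \ Δ) = Δ
    rw [Finset.sdiff_sdiff_eq_self (Finset.subset_univ Δ)]
  have hinj : Function.Injective c := fun Δ₁ Δ₂ h => by rw [← hcc Δ₁, ← hcc Δ₂]; exact congrArg c h
  have himg : c '' (pohlmannSets Φ p \ pohlmannDivisorSets Φ p) =
      pohlmannSets Φ (16 - p) \ pohlmannDivisorSets Φ (16 - p) := by
    apply Set.Subset.antisymm
    · rintro _ ⟨Δ, hΔ, rfl⟩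
      exact univ_sdiff_mem_diff hexp h32 φ₀ Φ hprim hp hΔ
    · intro Δ hΔ
      refine ⟨c Δ, ?_, hcc Δ⟩
      have := univ_sdiff_mem_diff hexp h32 φ₀ Φ hprim (p := 16 - p) (by omega) hΔ
      rwa [show 16 - (16 - p) = p by omega] at this
  rw [← himg, Set.ncard_image_of_injective _ hinj]

/-- **`dim Bᵖ(A) − dim Dᵖ(A) = dim B¹⁶⁻ᵖ(A) − dim D¹⁶⁻ᵖ(A)`** for every abelian `16`-fold of type `(K; Φ)`,
`[K:ℚ] = 32`, `Φ` primitive, `p ≤ 16`. [cite: Pohlmann1968, Thm. 1] [cite: Gordon1999HodgeAVSurvey, 9.2.2] -/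
theorem finrank_sub_eq_finrank_sub (hexp : ∀ g : K ≃ₐ[ℚ] K, g ^ 2 = 1) (h32 : finrank ℚ K = 32)
    (φ₀ : K →+* ℂ) (Φ : CMType K) (hprim : IsPrimitive (ℂ ≃+* ℂ) Φ.1 φ₀) (hA : IsCMTypeRealisation Φ A ι θ)
    {p : ℕ} (hp : p ≤ 16) :
    Module.finrank ℂ ↥(hodgeClassSpan (finrank ℚ K / 2) A.X p) -
        Module.finrank ℂ ↥(divisorClassesSpan A.X (finrank ℚ K / 2) p) =
      Module.finrank ℂ ↥(hodgeClassSpan (finrank ℚ K / 2) A.X (16 - p)) -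
        Module.finrank ℂ ↥(divisorClassesSpan A.X (finrank ℚ K / 2) (16 - p)) := by
  rw [finrank_hodgeClassSpan_sub_finrank_divisorClassesSpan hA p,
    finrank_hodgeClassSpan_sub_finrank_divisorClassesSpan hA (16 - p)]
  exact ncard_diff_eq_ncard_diff_sub hexp h32 φ₀ Φ hprim hp

/-- **EXACT COUNTS IN CODIMENSIONS `14` AND `13`: `dim B¹⁴ − dim D¹⁴ = 24`, `dim B¹³ − dim D¹³ = 288`** on every
simple degenerate CM `16`-fold with multiquadratic complex multiplication of degree `32` (§3, §4 and the symmetry).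
[cite: Pohlmann1968, Thm. 1] [cite: MoonenZarhin1998WeilClasses, Criterion (Q2)] [cite: Dodson1984, §3.2.1] -/
theorem finrank_sub_fourteen_thirteen_eq_of_isSimple (hexp : ∀ g : K ≃ₐ[ℚ] K, g ^ 2 = 1) (h32 : finrank ℚ K = 32)
    (Φ : CMType K) (hA : IsCMTypeRealisation Φ A ι θ) (hs : A.IsSimple) (hnd : ¬ IsNondegenerate Φ) :
    Module.finrank ℂ ↥(hodgeClassSpan (finrank ℚ K / 2) A.X 14) -
        Module.finrank ℂ ↥(divisorClassesSpan A.X (finrank ℚ K / 2) 14) = 24 ∧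
      Module.finrank ℂ ↥(hodgeClassSpan (finrank ℚ K / 2) A.X 13) -
        Module.finrank ℂ ↥(divisorClassesSpan A.X (finrank ℚ K / 2) 13) = 288 := by
  obtain ⟨φ₀⟩ := (inferInstance : Nonempty (K →+* ℂ))
  have hprim := (isSimple_iff_isPrimitive hA φ₀).1 hs
  have hr := cmTypeRank_eq_eleven_of_isSimple_of_not_isNondegenerate hexp h32 Φ hA hs hnd
  refine ⟨?_, ?_⟩
  · rw [finrank_sub_eq_finrank_sub hexp h32 φ₀ Φ hprim hA (by norm_num : 14 ≤ 16)]
    exact finrank_sub_two_eq_twentyfour hexp h32 φ₀ Φ hprim hr hA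
  · rw [finrank_sub_eq_finrank_sub hexp h32 φ₀ Φ hprim hA (by norm_num : 13 ≤ 16)]
    exact finrank_sub_three_eq hexp h32 φ₀ Φ hprim hr hA

end Symmetry

end MultiquadraticWeilSubfieldsDegreeEight

end Literature.AlgebraicGeometry.Pohlmann1968
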